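import Literature.Analysis.FluidPDE.AlbrittonRemainderSetup
import Literature.Analysis.FluidPDE.NormalisedPressureLpClass
import Literature.Analysis.FluidPDE.TaoEnstrophyLocalisationProofs
import Literature.Analysis.FluidPDE.SobolevWholeSpace
import Literature.Analysis.FluidPDE.CylinderTenThirds
import Literature.Analysis.FluidPDE.SuitableWeakPressure
import HarnessLib

/-!
# Albritton 2018, Prop. 4.5 and Cor. 4.6 over Albritton's class: the far field via Calderón's splitting

Analysis/FluidPDE proofs file on the discharge path of the corrected form of
`Literature.Analysis.FluidPDE.albritton_singular_point_of_blowup`. With the objects of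
`AlbrittonRemainderSetup.exists_calderon_remainder` (the classical representative `v` of a
restarted member of Albritton's class, the long-lived factor `V`, the energy-class bounds of
`W = v − V` up to the final time) this file proves that `v` is a **local Leray solution on the
full remaining slab** `(0, T − t₀) × ℝ³` (`IsLocalLeraySolutionOn`), whence — by the accepted
ε-regularity far-field theorem `IsLocalLeraySolutionOn.farField_bound_of_pressure_decay` — the
far-field `L^∞` bound of Albritton's class up to the blow-up time (Albritton 2018, (4.37)), the
hypothesis `hC` of the accepted reduction `katoClass_singular_point_of_farField`, and finally
**Cor. 4.6 over Albritton's class**: a maximal member of the class with `T* < ∞` has a singular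
point at time `T*`.

* §1 The difference of two Riesz pressures split into an `L²` and an `L^{5/3}` piece.
* §2 `‖|W(t)|²‖_{5/3}` from the energy class (Sobolev `H¹ ⊂ L⁶` and interpolation).
* §3 The gauge of the pressure and its continuity in time.
* §4 The clauses of `IsLocalLeraySolutionOn` on the full slab.
* §5 The far field, every viscosity, Cor. 4.6; the corrected named statement and its proof.

## References

* D. Albritton, Anal. PDE 11 (2018) = arXiv:1612.04439, Prop. 4.5, Cor. 4.6. [Albritton2018]
* P. G. Lemarié-Rieusset, *The Navier–Stokes Problem in the 21st Century* (2016), Def. 14.1,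
  Thm. 14.4, proof of Thm. 14.5 and Thm. 15.1. [LemarieRieusset2016]
* E. M. Stein, *Singular Integrals* (1970), Ch. II §4. [Stein1970]
-/

noncomputable section

open MeasureTheory TemperedDistribution TopologicalSpace Set Function Filter Metric
open _root_.Topology
open scoped SchwartzMap ENNReal NNReal RealInnerProductSpace

namespace Literature.Analysis.FluidPDE

namespace AlbrittonFarFieldCalderon

/-! ### §1 The difference of two Riesz pressures: an `L²` piece and an `L^{5/3}` piece -/

/-- **`p̃[a] − p̃[b] = Q₁ + Q₂`, `Q₁ ∈ L^{r₁}`, `Q₂ ∈ L^{r₂}`** (mixed exponents). For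
`1 < P, r₁, r₂ < ∞` there is `C` with: for measurable `a, b` with `|a|², |b|² ∈ L^P`,
`|a − b||b| ∈ L^{r₁}` and `|a − b|² ∈ L^{r₂}`, there are measurable `Q₁, Q₂` with
`p̃[a] − p̃[b] = Q₁ + Q₂` a.e., `‖Q₁‖_{r₁} ≤ C‖|a−b||b|‖_{r₁}`, `‖Q₂‖_{r₂} ≤ C‖|a−b||a−b|‖_{r₂}`
(`Q₁ = −⅔⟨c,b⟩ + 2 p.v.∫B(c,b)`, `Q₂ = −⅓|c|² + p.v.∫B(c,c)`, `c = a − b`; the pattern of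
`exists_normalisedPressure_sub_eq_add₃`). [cite: Stein1970, Ch. II §4.2 Thm 3 and §4.5 Thm 4; LemarieRieusset2016, Thm. 14.7, proof] -/
theorem exists_normalisedPressure_sub_eq_add {P r₁ r₂ : ℝ≥0∞} (hP1 : 1 < P) (hPt : P < ⊤)
    (hr₁1 : 1 < r₁) (hr₁t : r₁ < ⊤) (hr₂1 : 1 < r₂) (hr₂t : r₂ < ⊤) :
    ∃ C : ℝ≥0∞, C ≠ ⊤ ∧ ∀ (a b : (EuclideanSpace ℝ (Fin 3)) → (EuclideanSpace ℝ (Fin 3))),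
      AEStronglyMeasurable a volume → AEStronglyMeasurable b volume →
      MemLp (fun y => ‖a y‖ ^ 2) P volume → MemLp (fun y => ‖b y‖ ^ 2) P volume →
      MemLp (fun y => ‖a y - b y‖ * ‖b y‖) r₁ volume →
      MemLp (fun y => ‖a y - b y‖ * ‖a y - b y‖) r₂ volume →
      ∃ Q₁ Q₂ : (EuclideanSpace ℝ (Fin 3)) → ℝ, AEStronglyMeasurable Q₁ volume ∧
        AEStronglyMeasurable Q₂ volume ∧
        ((fun x => normalisedPressure a x - normalisedPressure b x) =ᵐ[volume] fun x => Q₁ x + Q₂ x) ∧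
        eLpNorm Q₁ r₁ volume ≤ C * eLpNorm (fun y => ‖a y - b y‖ * ‖b y‖) r₁ volume ∧
        eLpNorm Q₂ r₂ volume ≤ C * eLpNorm (fun y => ‖a y - b y‖ * ‖a y - b y‖) r₂ volume := by
  obtain ⟨A₁, hA₁t, hA₁⟩ := exists_eLpNorm_rieszTrunc_le (p := r₁) hr₁1 hr₁t
  obtain ⟨A₂, hA₂t, hA₂⟩ := exists_eLpNorm_rieszTrunc_le (p := r₂) hr₂1 hr₂t
  set K₁ : ℝ≥0∞ := 27 * 2⁻¹ * A₁ with hK₁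
  set K₂ : ℝ≥0∞ := 27 * 2⁻¹ * A₂ with hK₂
  have hK₁t : K₁ ≠ ⊤ := by simp only [hK₁]; finiteness
  have hK₂t : K₂ ≠ ⊤ := by simp only [hK₂]; finiteness
  set C : ℝ≥0∞ := 2 * 3⁻¹ + 2 * K₁ + (3⁻¹ + K₂) with hC
  have hCt : C ≠ ⊤ := by simp only [hC]; finiteness
  refine ⟨C, hCt, fun a b ha hb ha2 hb2 hcb hcc => ?_⟩
  set c : (EuclideanSpace ℝ (Fin 3)) → (EuclideanSpace ℝ (Fin 3)) := fun y => a y - b y with hc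
  have hcm : AEStronglyMeasurable c volume := ha.sub hb
  obtain ⟨P₁, hP₁m, hP₁, hP₁b⟩ := exists_bilinear_pv (f := c) (g := b) hr₁1 hr₁t hA₁ hcm hb hcb
  obtain ⟨P₂, hP₂m, hP₂, hP₂b⟩ := exists_bilinear_pv (f := c) (g := c) hr₂1 hr₂t hA₂ hcm hcm hcc
  have hPVa := ae_exists_hasPressurePV hP1 hPt ha ha2
  have hPVb := ae_exists_hasPressurePV hP1 hPt hb hb2
  set Q₁ : (EuclideanSpace ℝ (Fin 3)) → ℝ := fun x => -(2 * 3⁻¹) * ⟪c x, b x⟫ + 2 * P₁ x with hQ₁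
  set Q₂ : (EuclideanSpace ℝ (Fin 3)) → ℝ := fun x => -(3⁻¹) * ⟪c x, c x⟫ + P₂ x with hQ₂
  have hQ₁m : AEStronglyMeasurable Q₁ volume := ((hcm.inner hb).const_mul _).add (hP₁m.const_mul _)
  have hQ₂m : AEStronglyMeasurable Q₂ volume := ((hcm.inner hcm).const_mul _).add hP₂m
  refine ⟨Q₁, Q₂, hQ₁m, hQ₂m, ?_, ?_, ?_⟩
  · -- ## the identity a.e.
    set qP : ℝ≥0∞ := ENNReal.conjExponent P with hqP
    haveI hpqP : ENNReal.HolderConjugate P qP := ENNReal.HolderConjugate.conjExponent hP1.le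
    have hqP1 : 1 < qP := (ENNReal.HolderConjugate.lt_top_iff_one_lt P qP).1 hPt
    have hqPt : qP ≠ ⊤ := (ENNReal.HolderConjugate.ne_top_iff_ne_one qP P).2 (ne_of_gt hP1)
    set q₁ : ℝ≥0∞ := ENNReal.conjExponent r₁ with hq₁
    haveI hpq₁ : ENNReal.HolderConjugate r₁ q₁ := ENNReal.HolderConjugate.conjExponent hr₁1.le
    have hq₁1 : 1 < q₁ := (ENNReal.HolderConjugate.lt_top_iff_one_lt r₁ q₁).1 hr₁t
    have hq₁t : q₁ ≠ ⊤ := (ENNReal.HolderConjugate.ne_top_iff_ne_one q₁ r₁).2 (ne_of_gt hr₁1)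
    set q₂ : ℝ≥0∞ := ENNReal.conjExponent r₂ with hq₂
    haveI hpq₂ : ENNReal.HolderConjugate r₂ q₂ := ENNReal.HolderConjugate.conjExponent hr₂1.le
    have hq₂1 : 1 < q₂ := (ENNReal.HolderConjugate.lt_top_iff_one_lt r₂ q₂).1 hr₂t
    have hq₂t : q₂ ≠ ⊤ := (ENNReal.HolderConjugate.ne_top_iff_ne_one q₂ r₂).2 (ne_of_gt hr₂1)
    filter_upwards [hPVa, hPVb, hP₁, hP₂] with x hxa hxb hx₁ hx₂
    obtain ⟨La, hLa⟩ := hxa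
    obtain ⟨Lb, hLb⟩ := hxb
    have htrunc : ∀ ε : ℝ, 0 < ε → truncatedPressureIntegral a x ε - truncatedPressureIntegral b x ε =
        2 * (∫ y in (closedBall x ε)ᶜ, pressureForm (x - y) (c y) (b y)) +
          ∫ y in (closedBall x ε)ᶜ, pressureForm (x - y) (c y) (c y) := by
      intro ε hε
      have hIa := integrableOn_pressureKernel_of_memLp hqP1 hqPt ha ha2 x hε
      have hIb := integrableOn_pressureKernel_of_memLp hqP1 hqPt hb hb2 x hε
      have hI₁ := integrableOn_pressureForm_of_memLp hq₁1 hq₁t hcm hb hcb x hε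
      have hI₂ := integrableOn_pressureForm_of_memLp hq₂1 hq₂t hcm hcm hcc x hε
      rw [truncatedPressureIntegral_sub_eq hIa hIb]
      have hpt : ∀ y, pressureForm (x - y) ((a - b) y) ((a + b) y) =
          2 * pressureForm (x - y) (c y) (b y) + pressureForm (x - y) (c y) (c y) := by
        intro y
        have hsum : (a + b) y = (2 : ℝ) • b y + c y := by
          simp only [Pi.add_apply, hc, two_smul]
          abel
        rw [hsum, pressureForm_add_right, pressureForm_smul_right]
        rfl
      rw [integral_congr_ae (Eventually.of_forall hpt), integral_add (hI₁.const_mul 2) hI₂,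
        integral_const_mul]
    have hlim : Tendsto (fun ε => truncatedPressureIntegral a x ε - truncatedPressureIntegral b x ε) (𝓝[>] 0)
        (𝓝 (2 * P₁ x + P₂ x)) := by
      have h := (hx₁.const_mul 2).add hx₂
      refine h.congr' ?_
      filter_upwards [self_mem_nhdsWithin] with ε hε
      exact (htrunc ε hε).symm
    have hlim' : Tendsto (fun ε => truncatedPressureIntegral a x ε - truncatedPressureIntegral b x ε) (𝓝[>] 0)
        (𝓝 (La - Lb)) := hLa.2.sub hLb.2
    have hLL : La - Lb = 2 * P₁ x + P₂ x := tendsto_nhds_unique hlim' hlim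
    show normalisedPressure a x - normalisedPressure b x = Q₁ x + Q₂ x
    rw [normalisedPressure_sub_eq hLa hLb, hLL, norm_sq_sub_norm_sq_eq_inner]
    have hsum : a x + b x = (2 : ℝ) • b x + c x := by
      simp only [hc, two_smul]
      abel
    have hcx : a x - b x = c x := rfl
    rw [hcx, hsum, inner_add_right, real_inner_smul_right]
    simp only [hQ₁, hQ₂]
    ring
  · -- ## `‖Q₁‖_{r₁}`
    have h1le : (1 : ℝ≥0∞) ≤ r₁ := hr₁1.le
    have hm1 : AEStronglyMeasurable (fun x => -(2 * 3⁻¹) * ⟪c x, b x⟫) volume := (hcm.inner hb).const_mul _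
    have hm2 : AEStronglyMeasurable (fun x => 2 * P₁ x) volume := hP₁m.const_mul _
    calc eLpNorm Q₁ r₁ volume
        ≤ eLpNorm (fun x => -(2 * 3⁻¹) * ⟪c x, b x⟫) r₁ volume + eLpNorm (fun x => 2 * P₁ x) r₁ volume :=
          eLpNorm_add_le hm1 hm2 h1le
      _ ≤ 2 * 3⁻¹ * eLpNorm (fun y => ‖c y‖ * ‖b y‖) r₁ volume + 2 * (K₁ * eLpNorm (fun y => ‖c y‖ * ‖b y‖) r₁ volume) := by
          gcongr
          · have e1 : (fun x => -(2 * 3⁻¹) * ⟪c x, b x⟫) = (-(2 * 3⁻¹) : ℝ) • fun x => ⟪c x, b x⟫ := by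
              funext x; simp only [Pi.smul_apply, smul_eq_mul]
            rw [e1, eLpNorm_const_smul, enorm_neg, Real.enorm_eq_ofReal (by norm_num),
              ENNReal.ofReal_mul zero_le_two, ENNReal.ofReal_inv_of_pos (by norm_num), ENNReal.ofReal_ofNat,
              ENNReal.ofReal_ofNat]
            exact mul_le_mul' le_rfl (eLpNorm_inner_le c b r₁)
          · have e2 : (fun x => 2 * P₁ x) = (2 : ℝ) • P₁ := by
              funext x; simp only [Pi.smul_apply, smul_eq_mul]
            rw [e2, eLpNorm_const_smul, Real.enorm_eq_ofReal zero_le_two, ENNReal.ofReal_ofNat]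
            exact mul_le_mul' le_rfl hP₁b
      _ = (2 * 3⁻¹ + 2 * K₁) * eLpNorm (fun y => ‖c y‖ * ‖b y‖) r₁ volume := by rw [← mul_assoc, ← add_mul]
      _ ≤ C * eLpNorm (fun y => ‖c y‖ * ‖b y‖) r₁ volume := by
          gcongr; simp only [hC]; exact le_self_add
  · -- ## `‖Q₂‖_{r₂}`
    have h1le : (1 : ℝ≥0∞) ≤ r₂ := hr₂1.le
    have hm3 : AEStronglyMeasurable (fun x => -(3⁻¹) * ⟪c x, c x⟫) volume := (hcm.inner hcm).const_mul _
    calc eLpNorm Q₂ r₂ volume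
        ≤ eLpNorm (fun x => -(3⁻¹) * ⟪c x, c x⟫) r₂ volume + eLpNorm P₂ r₂ volume :=
          eLpNorm_add_le hm3 hP₂m h1le
      _ ≤ 3⁻¹ * eLpNorm (fun y => ‖c y‖ * ‖c y‖) r₂ volume + K₂ * eLpNorm (fun y => ‖c y‖ * ‖c y‖) r₂ volume := by
          gcongr
          · have e1 : (fun x => -(3⁻¹) * ⟪c x, c x⟫) = (-(3⁻¹) : ℝ) • fun x => ⟪c x, c x⟫ := by
              funext x; simp only [Pi.smul_apply, smul_eq_mul]
            rw [e1, eLpNorm_const_smul, enorm_neg, Real.enorm_eq_ofReal (by norm_num),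
              ENNReal.ofReal_inv_of_pos (by norm_num), ENNReal.ofReal_ofNat]
            exact mul_le_mul' le_rfl (eLpNorm_inner_le c c r₂)
      _ = (3⁻¹ + K₂) * eLpNorm (fun y => ‖c y‖ * ‖c y‖) r₂ volume := by rw [← add_mul]
      _ ≤ C * eLpNorm (fun y => ‖c y‖ * ‖c y‖) r₂ volume := by
          gcongr; simp only [hC]; exact le_add_self

/-! ### §2 `|W(t)|² ∈ L^{5/3}` from the energy class -/

/-- **`∫ |w|^{10/3} ≤ (∫ |w|²)^{2/3} K² ∫ |∇w|²_F`** for a `C¹ ∩ L²` field on `ℝ³` (the Sobolev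
inequality `H¹ ⊂ L⁶`, `eLpNorm_six_le_eLpNorm_fderiv_two`, the operator norm dominated by the
Frobenius norm, and the interpolation `lintegral_rpow_tenThirds_le_Lp_interpolation`). [cite: LemarieRieusset2016, (13.17)–(13.18) p. 461 and §13.9 p. 468] -/
theorem lintegral_tenThirds_le {w : (EuclideanSpace ℝ (Fin 3)) → (EuclideanSpace ℝ (Fin 3))}
    (hw : ContDiff ℝ 1 w) (hw2 : MemLp w 2 volume) :
    ∫⁻ x, ‖w x‖ₑ ^ (10 / 3 : ℝ) ≤
      (∫⁻ x, ‖w x‖ₑ ^ (2 : ℕ)) ^ (2 / 3 : ℝ) *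
        ((SNormLESNormFDerivOfEqConst (EuclideanSpace ℝ (Fin 3)) (volume : Measure (EuclideanSpace ℝ (Fin 3))) 2 : ℝ≥0∞) ^ 2 *
          ∫⁻ x, ENNReal.ofReal (frobeniusNormSq (fderiv ℝ w x))) := by
  have hI := lintegral_rpow_tenThirds_le_Lp_interpolation (volume : Measure (EuclideanSpace ℝ (Fin 3)))
    (f := fun x => ‖w x‖ₑ) hw2.1.enorm
  refine hI.trans (mul_le_mul' le_rfl ?_)
  -- `(∫ |w|⁶)^{1/3} = ‖w‖₆² ≤ (K ‖Dw‖₂)² ≤ K² ∫ |Dw|²_F`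
  have hS := eLpNorm_six_le_eLpNorm_fderiv_two (volume : Measure (EuclideanSpace ℝ (Fin 3)))
    finrank_euclideanSpace_fin hw hw2.eLpNorm_lt_top
  have h6 : (∫⁻ x, ‖w x‖ₑ ^ (6 : ℝ)) ^ (1 / 3 : ℝ) = eLpNorm w 6 volume ^ 2 := by
    rw [eLpNorm_eq_lintegral_rpow_enorm_toReal (by norm_num) (by norm_num), ENNReal.toReal_ofNat,
      ← ENNReal.rpow_natCast, ← ENNReal.rpow_mul]
    norm_num
  rw [h6]
  calc eLpNorm w 6 volume ^ 2
      ≤ (SNormLESNormFDerivOfEqConst (EuclideanSpace ℝ (Fin 3)) (volume : Measure (EuclideanSpace ℝ (Fin 3))) 2 *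
          eLpNorm (fderiv ℝ w) 2 volume) ^ 2 := by gcongr
    _ = (SNormLESNormFDerivOfEqConst (EuclideanSpace ℝ (Fin 3)) (volume : Measure (EuclideanSpace ℝ (Fin 3))) 2 : ℝ≥0∞) ^ 2 *
          eLpNorm (fderiv ℝ w) 2 volume ^ 2 := by rw [mul_pow]
    _ ≤ _ := by
        gcongr
        -- `‖Dw‖₂² = ∫ ‖Dw‖² ≤ ∫ |Dw|²_F`
        rw [eLpNorm_eq_lintegral_rpow_enorm_toReal (by norm_num) (by norm_num), ENNReal.toReal_ofNat,
          ← ENNReal.rpow_natCast, ← ENNReal.rpow_mul]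
        norm_num
        refine lintegral_mono fun x => ?_
        rw [show ‖fderiv ℝ w x‖ₑ ^ 2 = ENNReal.ofReal (‖fderiv ℝ w x‖ ^ 2) by
          rw [← ofReal_norm, ENNReal.ofReal_pow (norm_nonneg _)]]
        exact ENNReal.ofReal_le_ofReal (sq_opNorm_le_frobeniusNormSq _)


/-! ### §3 The gauge of the pressure and its continuity in time -/

section Gauge

variable {p q : ℝ≥0∞} [hp1 : Fact (1 ≤ p)] {T : ℝ}
  {u : ℝ → EuclideanSpace ℝ (Fin 3) → EuclideanSpace ℝ (Fin 3)}
  {U : ℝ → 𝓢'(EuclideanSpace ℝ (Fin 3), EuclideanSpace ℂ (Fin 3))}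

/-- **A pairing against a fixed `L^{Q'}` function is `L^P`-Lipschitz** (Hölder at exponent one,
real form): `|∫ g θ| ≤ (‖g‖_P ‖θ‖_{Q'}).toReal`. [folklore] -/
theorem abs_integral_mul_le_toReal {P Q' : ℝ≥0∞} [ENNReal.HolderTriple P Q' 1]
    {g θ : (EuclideanSpace ℝ (Fin 3)) → ℝ} (hg : MemLp g P volume) (hθ : MemLp θ Q' volume) :
    |∫ y, g y * θ y| ≤ (eLpNorm g P volume * eLpNorm θ Q' volume).toReal := by
  have hH : eLpNorm (fun y => g y * θ y) 1 volume ≤ eLpNorm g P volume * eLpNorm θ Q' volume := by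
    have h := eLpNorm_le_eLpNorm_mul_eLpNorm_of_nnnorm hg.1 hθ.1 (· * ·) 1
      (Eventually.of_forall fun y => by simp [nnnorm_mul]) (p := P) (q := Q') (r := 1)
    simpa using h
  have htop : eLpNorm g P volume * eLpNorm θ Q' volume ≠ ⊤ :=
    ENNReal.mul_ne_top hg.eLpNorm_ne_top hθ.eLpNorm_ne_top
  calc |∫ y, g y * θ y| = ‖∫ y, g y * θ y‖ := (Real.norm_eq_abs _).symm
    _ ≤ ∫ y, ‖g y * θ y‖ := norm_integral_le_integral_norm _
    _ = (∫⁻ y, ‖g y * θ y‖ₑ).toReal := integral_norm_eq_lintegral_enorm (hg.1.mul hθ.1)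
    _ = (eLpNorm (fun y => g y * θ y) 1 volume).toReal := by rw [eLpNorm_one_eq_lintegral_enorm]
    _ ≤ (eLpNorm g P volume * eLpNorm θ Q' volume).toReal := ENNReal.toReal_mono htop hH

/-- **The gauge of the classical pressure is continuous in time.** Let `u` be a member of
Albritton's class on `[0, T)` (unit viscosity), `t₀ ∈ (0, T)`, and `(v, π)` a classical solution
on `(-t₀/2, T - t₀)` with `v t = u(t + t₀)` a.e. (`t ∈ [0, T - t₀)`) and slices bounded in `L^p`
on every `(0, S₁)`, `S₁ < T - t₀`. Then there is `c : ℝ → ℝ`, continuous on `(0, T - t₀)`, with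
`π(t) − c(t) = p̃[v(t)]` a.e. for every `t ∈ (0, T - t₀)`: `c(t)` is the normalisation constant of
`pressure_ae_eq_normalisedPressure_add_const`; against a normed bump `θ`,
`c(t) = ∫ π(t)θ − ∫ p̃[v(t)]θ`, and `t ↦ p̃[v(t)]` is continuous in `L^{p/2}` because
`t ↦ v(t)` is continuous in `L^p` (the class is `C([0,T); L^p)`) and `w ↦ p̃[w]` is locally
Lipschitz `L^p → L^{p/2}` (`exists_eLpNorm_normalisedPressure_sub_le`). [cite: Albritton2018, Prop. 4.5 proof; Tao2011, Lemma 4.1 (i); Stein1970, Ch. II §4.2 Thm 3] -/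
theorem exists_continuous_gauge (hp₃ : 3 < p) (hp : p < ⊤) (hT : 0 < T)
    (h : IsKatoBesovMildSolutionOn p q T 1 u U) {t₀ : ℝ} (ht₀ : t₀ ∈ Ioo 0 T)
    {v : ℝ → EuclideanSpace ℝ (Fin 3) → EuclideanSpace ℝ (Fin 3)}
    {π : ℝ → EuclideanSpace ℝ (Fin 3) → ℝ}
    (hvcl : IsClassicalNSSolutionOn (Ioo (-(t₀ / 2)) (T - t₀)) 1 0 v π)
    (hvu : ∀ t ∈ Ico 0 (T - t₀), v t =ᵐ[volume] u (t + t₀))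
    (hLpb : ∀ S₁, S₁ < T - t₀ → ∃ N : ℝ≥0, ∀ t ∈ Ioo 0 S₁, MemLp (v t) p volume ∧
      eLpNorm (v t) p volume ≤ N) :
    ∃ c : ℝ → ℝ, ContinuousOn c (Ioo 0 (T - t₀)) ∧
      ∀ t ∈ Ioo 0 (T - t₀), ∀ᵐ x ∂(volume : Measure (EuclideanSpace ℝ (Fin 3))),
        π t x - c t = normalisedPressure (v t) x := by
  have _ := hT
  set S : ℝ := T - t₀ with hSdef
  -- exponents
  have h2p : 2 < p := lt_trans (by norm_num) hp₃
  have hP1 : (1 : ℝ≥0∞) < p / 2 := by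
    rw [ENNReal.lt_div_iff_mul_lt (Or.inl two_ne_zero) (Or.inl ENNReal.ofNat_ne_top), one_mul]
    exact h2p
  have hPt : p / 2 < ⊤ := ENNReal.div_lt_top hp.ne two_ne_zero
  have h2P : 2 * (p / 2) = p := ENNReal.mul_div_cancel two_ne_zero ENNReal.ofNat_ne_top
  -- ### the normalisation at each time
  have hnorm : ∀ t ∈ Ioo 0 S, ∃ C : ℝ, ∀ᵐ x ∂(volume : Measure (EuclideanSpace ℝ (Fin 3))),
      π t x = normalisedPressure (v t) x + C := by
    intro t ht
    set S₁ : ℝ := (t + S) / 2 with hS₁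
    have htS₁ : t < S₁ := by rw [hS₁]; linarith [ht.2]
    have hS₁S : S₁ < S := by rw [hS₁]; linarith [ht.2]
    obtain ⟨N, hN⟩ := hLpb S₁ hS₁S
    have hv' : IsClassicalNSSolutionOn (Ioo 0 S₁) 1 0 v π :=
      hvcl.mono (Ioo_subset_Ioo (by linarith [ht₀.1]) hS₁S.le) (uniqueDiffOn_Ioo 0 S₁)
    have hu' : ∀ s ∈ Ioo 0 S₁, MemLp (v s) (2 * (p / 2)) volume := fun s hs => by
      rw [h2P]; exact (hN s hs).1
    have hM' : ∀ s ∈ Ioo 0 S₁, eLpNorm (v s) (2 * (p / 2)) volume ≤ N := fun s hs => by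
      rw [h2P]; exact (hN s hs).2
    exact NormalisedPressureDifferenceMixed.pressure_ae_eq_normalisedPressure_add_const zero_le_one hv'
      hP1 hPt hu' hM' ⟨ht.1, htS₁⟩
  classical
  set c : ℝ → ℝ := fun t => if ht : t ∈ Ioo 0 S then Classical.choose (hnorm t ht) else 0 with hcdef
  have hc : ∀ t ∈ Ioo 0 S, ∀ᵐ x ∂(volume : Measure (EuclideanSpace ℝ (Fin 3))),
      π t x - c t = normalisedPressure (v t) x := by
    intro t ht
    have h1 := Classical.choose_spec (hnorm t ht)
    filter_upwards [h1] with x hx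
    simp only [hcdef, dif_pos ht]
    linarith
  refine ⟨c, ?_, hc⟩
  -- ### continuity: `c = A - B` with `A t = ∫ π t θ`, `B t = ∫ p̃[v t] θ`
  set φ : ContDiffBump (0 : EuclideanSpace ℝ (Fin 3)) := ⟨1, 2, one_pos, one_lt_two⟩ with hφ
  set θ : EuclideanSpace ℝ (Fin 3) → ℝ := φ.normed volume with hθ
  have hθs : ContDiff ℝ (⊤ : ℕ∞) θ := φ.contDiff_normed
  have hθc : HasCompactSupport θ := φ.hasCompactSupport_normed
  have hθcont : Continuous θ := hθs.continuous
  have hθint : ∫ x, θ x = 1 := φ.integral_normed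
  have hθmem : ∀ r : ℝ≥0∞, MemLp θ r volume := fun r => hθcont.memLp_of_hasCompactSupport hθc
  set A : ℝ → ℝ := fun t => ∫ x, π t x * θ x with hA
  set B : ℝ → ℝ := fun t => ∫ x, normalisedPressure (v t) x * θ x with hB
  -- `p̃[v t] ∈ L^{p/2}` and the identity `c = A - B` on `(0, S)`
  have hmemP : ∀ t ∈ Ioo 0 S, MemLp (normalisedPressure (v t)) (p / 2) volume := by
    intro t ht
    obtain ⟨N, hN⟩ := hLpb ((t + S) / 2) (by linarith [ht.2])
    have hm : MemLp (v t) (2 * (p / 2)) volume := by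
      rw [h2P]; exact (hN t ⟨ht.1, by linarith [ht.2]⟩).1
    exact memLp_normalisedPressure_of_memLp_two_mul hP1 hPt hm
  have hπθ : ∀ t ∈ Ioo 0 S, Integrable (fun x => π t x * θ x) volume := by
    intro t ht
    have htO : t ∈ Ioo (-(t₀ / 2)) (T - t₀) := ⟨by linarith [ht.1, ht₀.1], ht.2⟩
    exact ((hvcl.contDiff_pressure htO).continuous.mul hθcont).integrable_of_hasCompactSupport hθc.mul_left
  have hcAB : ∀ t ∈ Ioo 0 S, c t = A t - B t := by
    intro t ht
    have hae := hc t ht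
    have e1 : B t = ∫ x, (π t x - c t) * θ x := by
      simp only [hB]
      refine integral_congr_ae ?_
      filter_upwards [hae] with x hx
      rw [hx]
    have e2 : ∫ x, (π t x - c t) * θ x = A t - c t := by
      have : (fun x => (π t x - c t) * θ x) = fun x => π t x * θ x - c t * θ x := by
        funext x; ring
      rw [this, integral_sub (hπθ t ht) ((memLp_one_iff_integrable.1 (hθmem 1)).const_mul _), integral_const_mul,
        hθint, mul_one]
    rw [e1, e2]; ring
  -- `A` is continuous on `(0, S)` (parametric integral, compact `x`-support)
  have hAcont : ContinuousOn A (Ioo 0 S) := by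
    have hO : Ioo 0 S ⊆ Ioo (-(t₀ / 2)) (T - t₀) := Ioo_subset_Ioo (by linarith [ht₀.1]) le_rfl
    refine (FluidPDE.continuousOn_integral_of_support_subset (μ := volume) (K := tsupport θ) hθc ?_ ?_).mono hO
    · exact hvcl.smooth_pressure.continuousOn.mul ((hθcont.comp continuous_snd).continuousOn)
    · intro t _ x hx
      show π t x * θ x = 0
      rw [image_eq_zero_of_notMem_tsupport hx, mul_zero]
  -- `B` is continuous on `(0, S)`: `L^p`-continuity of `t ↦ v t` and `L^p → L^{p/2}` of `p̃`
  obtain ⟨Cst, hCstt, hCst⟩ := exists_eLpNorm_normalisedPressure_sub_le (p := p / 2) hP1 hPt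
  set Q' : ℝ≥0∞ := ENNReal.conjExponent (p / 2) with hQ'
  haveI hPQ : ENNReal.HolderConjugate (p / 2) Q' := ENNReal.HolderConjugate.conjExponent hP1.le
  haveI hT2 : ENNReal.HolderTriple (2 * (p / 2)) (2 * (p / 2)) (p / 2) := holderTriple_two_mul (p / 2)
  have hBcont : ContinuousOn B (Ioo 0 S) := by
    intro t ht
    -- the `L^p` bound near `t`
    set S₁ : ℝ := (t + S) / 2 with hS₁
    have htS₁ : t < S₁ := by rw [hS₁]; linarith [ht.2]
    have hS₁S : S₁ < S := by rw [hS₁]; linarith [ht.2]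
    obtain ⟨N, hN⟩ := hLpb S₁ hS₁S
    -- `‖v t' - v t‖_p → 0` as `t' → t` within `(0, S)`
    have htt₀ : t + t₀ ∈ Ioo 0 T := ⟨by linarith [ht.1, ht₀.1], by rw [hSdef] at ht; linarith [ht.2]⟩
    have hcu : Tendsto (fun τ => eLpNorm (u τ - u (t + t₀)) p volume) (𝓝[Ioo 0 T] (t + t₀)) (𝓝 0) :=
      h.continuousInLpOn.2 (t + t₀) htt₀
    have hshift : Tendsto (fun t' : ℝ => t' + t₀) (𝓝[Ioo 0 S] t) (𝓝[Ioo 0 T] (t + t₀)) := by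
      refine tendsto_nhdsWithin_of_tendsto_nhds_of_eventually_within _ ?_ ?_
      · exact ((continuous_id.add continuous_const).tendsto t).mono_left nhdsWithin_le_nhds
      · filter_upwards [self_mem_nhdsWithin] with t' ht'
        exact ⟨by linarith [ht'.1, ht₀.1], by rw [hSdef] at ht'; linarith [ht'.2]⟩
    have hcv : Tendsto (fun t' => eLpNorm (fun y => v t' y - v t y) p volume) (𝓝[Ioo 0 S] t) (𝓝 0) := by
      have h1 := hcu.comp hshift
      refine h1.congr' ?_
      filter_upwards [self_mem_nhdsWithin] with t' ht'
      have e1 : (fun y => v t' y - v t y) =ᵐ[volume] (u (t' + t₀) - u (t + t₀)) := by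
        filter_upwards [hvu t' ⟨ht'.1.le, ht'.2⟩, hvu t ⟨ht.1.le, ht.2⟩] with y hy hy'
        simp only [Pi.sub_apply, hy, hy']
      simp only [comp_apply]
      exact (eLpNorm_congr_ae e1).symm
    -- the bound `|B t' - B t| ≤ (Cst ‖v t' - v t‖_p (2N) ‖θ‖_{Q'}).toReal` near `t`
    have hev : ∀ᶠ t' in 𝓝[Ioo 0 S] t, |B t' - B t| ≤
        (Cst * (eLpNorm (fun y => v t' y - v t y) p volume * (N + N)) * eLpNorm θ Q' volume).toReal := by
      have hnear : ∀ᶠ t' in 𝓝[Ioo 0 S] t, t' ∈ Ioo 0 S₁ := by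
        filter_upwards [inter_mem_nhdsWithin (Ioo 0 S) (Iio_mem_nhds htS₁)] with t' ht'
        exact ⟨ht'.1.1, ht'.2⟩
      filter_upwards [hnear] with t' ht'
      have ht'S : t' ∈ Ioo 0 S := ⟨ht'.1, ht'.2.trans hS₁S⟩
      have hmt' := hmemP t' ht'S
      have hmt := hmemP t ht
      have hdiff : B t' - B t = ∫ x, (normalisedPressure (v t') x - normalisedPressure (v t) x) * θ x := by
        have i1 : Integrable (fun x => normalisedPressure (v t') x * θ x) volume := hmt'.integrable_mul (hθmem Q')
        have i2 : Integrable (fun x => normalisedPressure (v t) x * θ x) volume := hmt.integrable_mul (hθmem Q')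
        simp only [hB]
        rw [← integral_sub i1 i2]
        refine integral_congr_ae (Eventually.of_forall fun x => ?_)
        ring
      rw [hdiff]
      have hg : MemLp (fun x => normalisedPressure (v t') x - normalisedPressure (v t) x) (p / 2) volume :=
        hmt'.sub hmt
      refine (abs_integral_mul_le_toReal hg (hθmem Q')).trans (ENNReal.toReal_mono ?_ ?_)
      · refine ENNReal.mul_ne_top (ENNReal.mul_ne_top hCstt (ENNReal.mul_ne_top ?_ (by simp))) (hθmem Q').eLpNorm_ne_top
        exact ((hN t' ht').1.sub (hN t ⟨ht.1, htS₁⟩).1).eLpNorm_ne_top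
      refine mul_le_mul' ?_ le_rfl
      -- `‖p̃[v t'] - p̃[v t]‖_{p/2} ≤ Cst ‖|v t' - v t||v t' + v t|‖_{p/2} ≤ Cst ‖v t'-v t‖_p ‖v t'+v t‖_p`
      have hvt'm := (hN t' ht').1
      have hvtm := (hN t ⟨ht.1, htS₁⟩).1
      have ha2 : MemLp (fun y => ‖v t' y‖ ^ 2) (p / 2) volume := by
        refine memLp_norm_sq_of_memLp_two_mul ?_; rw [h2P]; exact hvt'm
      have hb2 : MemLp (fun y => ‖v t y‖ ^ 2) (p / 2) volume := by
        refine memLp_norm_sq_of_memLp_two_mul ?_; rw [h2P]; exact hvtm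
      refine (hCst (v t') (v t) hvt'm.1 hvtm.1 ha2 hb2).trans (mul_le_mul' le_rfl ?_)
      have hH := eLpNorm_norm_mul_norm_le_two_mul (f := fun y => v t' y - v t y) (g := fun y => v t' y + v t y)
        (hvt'm.1.sub hvtm.1) (hvt'm.1.add hvtm.1) (p / 2)
      rw [h2P] at hH
      refine hH.trans (mul_le_mul' le_rfl ?_)
      calc eLpNorm (fun y => v t' y + v t y) p volume ≤ eLpNorm (v t') p volume + eLpNorm (v t) p volume :=
            eLpNorm_add_le hvt'm.1 hvtm.1 hp1.out
        _ ≤ N + N := add_le_add (hN t' ht').2 (hN t ⟨ht.1, htS₁⟩).2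
    -- the majorant tends to `0`
    have hmaj : Tendsto (fun t' => (Cst * (eLpNorm (fun y => v t' y - v t y) p volume * (N + N)) *
        eLpNorm θ Q' volume).toReal) (𝓝[Ioo 0 S] t) (𝓝 0) := by
      have h1 : Tendsto (fun t' => eLpNorm (fun y => v t' y - v t y) p volume * (N + N)) (𝓝[Ioo 0 S] t) (𝓝 0) := by
        have := ENNReal.Tendsto.mul_const hcv (Or.inr (by simp : ((N : ℝ≥0∞) + N) ≠ ⊤))
        rwa [zero_mul] at this
      have h2 : Tendsto (fun t' => Cst * (eLpNorm (fun y => v t' y - v t y) p volume * (N + N))) (𝓝[Ioo 0 S] t) (𝓝 0) := by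
        have := ENNReal.Tendsto.const_mul h1 (Or.inr hCstt)
        rwa [mul_zero] at this
      have h3 : Tendsto (fun t' => Cst * (eLpNorm (fun y => v t' y - v t y) p volume * (N + N)) *
          eLpNorm θ Q' volume) (𝓝[Ioo 0 S] t) (𝓝 0) := by
        have := ENNReal.Tendsto.mul_const h2 (Or.inr (hθmem Q').eLpNorm_ne_top)
        rwa [zero_mul] at this
      have h4 := (ENNReal.tendsto_toReal ENNReal.zero_ne_top).comp h3
      rwa [ENNReal.toReal_zero] at h4
    have hlim : Tendsto (fun t' => B t' - B t) (𝓝[Ioo 0 S] t) (𝓝 0) :=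
      squeeze_zero_norm' (by simpa only [Real.norm_eq_abs] using hev) hmaj
    have := hlim.add_const (B t)
    simp only [sub_add_cancel, zero_add] at this
    exact this
  -- assemble
  have hccont : ContinuousOn (fun t => A t - B t) (Ioo 0 S) := hAcont.sub hBcont
  exact hccont.congr (fun t ht => hcAB t ht)

end Gauge


/-! ### §4 Local Leray solutions on the full remaining slab -/

section Clauses

variable {p q : ℝ≥0∞} [hp1 : Fact (1 ≤ p)] {T : ℝ}
  {u : ℝ → EuclideanSpace ℝ (Fin 3) → EuclideanSpace ℝ (Fin 3)}
  {U : ℝ → 𝓢'(EuclideanSpace ℝ (Fin 3), EuclideanSpace ℂ (Fin 3))}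

/-- `‖a‖ₑ² ≤ 2‖a − b‖ₑ² + 2‖b‖ₑ²`. [folklore] -/
theorem enorm_sq_le_two_mul {F : Type*} [NormedAddCommGroup F] (a b : F) :
    ‖a‖ₑ ^ 2 ≤ 2 * ‖a - b‖ₑ ^ 2 + 2 * ‖b‖ₑ ^ 2 := by
  have h : ‖a‖ ^ 2 ≤ 2 * ‖a - b‖ ^ 2 + 2 * ‖b‖ ^ 2 := by
    have h1 : ‖a‖ ≤ ‖a - b‖ + ‖b‖ := by
      calc ‖a‖ = ‖(a - b) + b‖ := by rw [sub_add_cancel]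
        _ ≤ ‖a - b‖ + ‖b‖ := norm_add_le _ _
    nlinarith [norm_nonneg (a - b), norm_nonneg b, norm_nonneg a, sq_nonneg (‖a - b‖ - ‖b‖)]
  calc ‖a‖ₑ ^ 2 = ENNReal.ofReal (‖a‖ ^ 2) := by rw [← ofReal_norm, ENNReal.ofReal_pow (norm_nonneg _)]
    _ ≤ ENNReal.ofReal (2 * ‖a - b‖ ^ 2 + 2 * ‖b‖ ^ 2) := ENNReal.ofReal_le_ofReal h
    _ = 2 * ‖a - b‖ₑ ^ 2 + 2 * ‖b‖ₑ ^ 2 := by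
        rw [ENNReal.ofReal_add (by positivity) (by positivity), ENNReal.ofReal_mul zero_le_two,
          ENNReal.ofReal_mul zero_le_two, ENNReal.ofReal_pow (norm_nonneg _),
          ENNReal.ofReal_pow (norm_nonneg _), ofReal_norm, ofReal_norm, ENNReal.ofReal_ofNat]

/-- `|L|²_F ≤ 2|L − L'|²_F + 2|L'|²_F` for the Frobenius norm. [folklore] -/
theorem frobeniusNormSq_le_two_mul_sub_add
    (L L' : EuclideanSpace ℝ (Fin 3) →L[ℝ] EuclideanSpace ℝ (Fin 3)) :
    frobeniusNormSq L ≤ 2 * frobeniusNormSq (L - L') + 2 * frobeniusNormSq L' := by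
  unfold frobeniusNormSq
  rw [Finset.mul_sum, Finset.mul_sum, ← Finset.sum_add_distrib]
  refine Finset.sum_le_sum fun i _ => ?_
  have h1 : ‖L ((stdOrthonormalBasis ℝ (EuclideanSpace ℝ (Fin 3))) i)‖ ≤
      ‖(L - L') ((stdOrthonormalBasis ℝ (EuclideanSpace ℝ (Fin 3))) i)‖ +
        ‖L' ((stdOrthonormalBasis ℝ (EuclideanSpace ℝ (Fin 3))) i)‖ := by
    calc _ = ‖(L _ - L' _) + L' ((stdOrthonormalBasis ℝ (EuclideanSpace ℝ (Fin 3))) i)‖ := by rw [sub_add_cancel]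
      _ ≤ _ := norm_add_le _ _
  nlinarith [h1, norm_nonneg (L ((stdOrthonormalBasis ℝ (EuclideanSpace ℝ (Fin 3))) i)),
    norm_nonneg ((L - L') ((stdOrthonormalBasis ℝ (EuclideanSpace ℝ (Fin 3))) i)),
    norm_nonneg (L' ((stdOrthonormalBasis ℝ (EuclideanSpace ℝ (Fin 3))) i)),
    sq_nonneg (‖(L - L') ((stdOrthonormalBasis ℝ (EuclideanSpace ℝ (Fin 3))) i)‖ -
      ‖L' ((stdOrthonormalBasis ℝ (EuclideanSpace ℝ (Fin 3))) i)‖)]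

/-- `∫⁻ ‖f‖ₑ² = ofReal (∫ ‖f‖²)` for `‖f‖² ∈ L¹`. [folklore] -/
theorem lintegral_enorm_sq_eq_ofReal {F : Type*} [NormedAddCommGroup F]
    {f : EuclideanSpace ℝ (Fin 3) → F} (hf : Integrable (fun x => ‖f x‖ ^ 2) volume) :
    ∫⁻ x, ‖f x‖ₑ ^ 2 = ENNReal.ofReal (∫ x, ‖f x‖ ^ 2) := by
  rw [ofReal_integral_eq_lintegral_ofReal hf (Eventually.of_forall fun x => by positivity)]
  refine lintegral_congr fun x => ?_
  rw [← ofReal_norm, ENNReal.ofReal_pow (norm_nonneg _)]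

/-- `x^{9/10} ≤ 1 + x` in `ℝ≥0∞`. [folklore] -/
theorem rpow_nine_tenths_le (x : ℝ≥0∞) : x ^ (9 / 10 : ℝ) ≤ 1 + x := by
  rcases le_or_gt x 1 with h | h
  · exact (ENNReal.rpow_le_one h (by norm_num)).trans le_self_add
  · exact ((ENNReal.rpow_le_rpow_of_exponent_le h.le (by norm_num : (9 / 10 : ℝ) ≤ 1)).trans_eq
      (ENNReal.rpow_one x)).trans le_add_self

/-- **Hölder down to `L^{3/2}` on a set**: for `3/2 ≤ r` and measurable `g`,
`∫_K ‖g‖ₑ^{3/2} ≤ (‖g‖_{L^r} · vol(K)^{2/3 − 1/r})^{3/2}`. [folklore] -/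
theorem setLIntegral_rpow_threeHalves_le {g : EuclideanSpace ℝ (Fin 3) → ℝ} {K : Set (EuclideanSpace ℝ (Fin 3))}
    (hg : AEStronglyMeasurable g volume) {r : ℝ≥0∞} (hr : (3 / 2 : ℝ≥0∞) ≤ r) :
    ∫⁻ x in K, ‖g x‖ₑ ^ (3 / 2 : ℝ) ≤
      (eLpNorm g r volume * volume K ^ (2 / 3 - 1 / r.toReal : ℝ)) ^ (3 / 2 : ℝ) := by
  have h32 : (3 / 2 : ℝ≥0∞) ≠ 0 := by norm_num
  have h32t : (3 / 2 : ℝ≥0∞) ≠ ⊤ := by finiteness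
  have h32r : (3 / 2 : ℝ≥0∞).toReal = 3 / 2 := by
    rw [ENNReal.toReal_div]; norm_num
  have h1 := lintegral_enorm_rpow_toReal_eq (μ := volume.restrict K) g h32 h32t
  rw [h32r] at h1
  rw [h1]
  refine ENNReal.rpow_le_rpow ?_ (by norm_num)
  have h2 := eLpNorm_le_eLpNorm_mul_rpow_measure_univ hr hg.restrict (μ := volume.restrict K)
  rw [Measure.restrict_apply_univ, h32r, show (1 : ℝ) / (3 / 2) = 2 / 3 by norm_num] at h2
  refine h2.trans ?_
  exact mul_le_mul' (eLpNorm_mono_measure g Measure.restrict_le_self) le_rfl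

/-- **The `L^{3/2}(K)` bound of the pressure slice** `p̃[a]`, `a = W + b`, in terms of the
energy-class quantities of `W` and the `L^p ∩ L^∞` size of `b` (the decomposition
`p̃[a] = Q₁ + Q₂ + p̃[b]`, `Q₁ ∈ L²`, `Q₂ ∈ L^{3/2}` via `W ∈ L³ ⊂ [L², L^{10/3}]` and Sobolev,
`p̃[b] ∈ L^{p/2}`; Hölder down to `3/2` on `K`). The constants depend on `p`, the bounds and `K`
only; the dissipation `D = ∫ |∇W|²_F` enters linearly. [cite: Albritton2018, Prop. 4.5 proof; LemarieRieusset2016, (13.18) p. 461; Stein1970, Ch. II §4] -/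
theorem exists_setLIntegral_pressure_slice_le {p : ℝ≥0∞} (hp₃ : 3 < p) (hp : p < ⊤) {M Λs : ℝ}
    (hM : 0 ≤ M) (NV : ℝ≥0) {K : Set (EuclideanSpace ℝ (Fin 3))} (hK : volume K ≠ ⊤) :
    ∃ B₀ B₁ : ℝ≥0∞, B₀ ≠ ⊤ ∧ B₁ ≠ ⊤ ∧
      ∀ (a b : EuclideanSpace ℝ (Fin 3) → EuclideanSpace ℝ (Fin 3)) (g : EuclideanSpace ℝ (Fin 3) → ℝ),
        Continuous a → Continuous b → MemLp a p volume → MemLp b p volume →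
        eLpNorm b p volume ≤ NV → (∀ x, ‖b x‖ ≤ M) →
        ContDiff ℝ 1 (fun y => a y - b y) → Integrable (fun y => ‖a y - b y‖ ^ 2) volume →
        ∫ y, ‖a y - b y‖ ^ 2 ≤ Λs →
        ∫⁻ y, ENNReal.ofReal (frobeniusNormSq (fderiv ℝ (fun y => a y - b y) y)) < ⊤ →
        (g =ᵐ[volume] normalisedPressure a) →
        ∫⁻ x in K, ‖g x‖ₑ ^ (3 / 2 : ℝ) ≤
          B₀ + B₁ * (1 + ∫⁻ y, ENNReal.ofReal (frobeniusNormSq (fderiv ℝ (fun y => a y - b y) y))) := by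
  -- ### exponents
  have h2p : 2 < p := lt_trans (by norm_num) hp₃
  have hP1 : (1 : ℝ≥0∞) < p / 2 := by
    rw [ENNReal.lt_div_iff_mul_lt (Or.inl two_ne_zero) (Or.inl ENNReal.ofNat_ne_top), one_mul]
    exact h2p
  have hPt : p / 2 < ⊤ := ENNReal.div_lt_top hp.ne two_ne_zero
  have h2P : 2 * (p / 2) = p := ENNReal.mul_div_cancel two_ne_zero ENNReal.ofNat_ne_top
  have h32P : (3 / 2 : ℝ≥0∞) ≤ p / 2 := ENNReal.div_le_div_right hp₃.le 2
  have h2_1 : (1 : ℝ≥0∞) < 2 := by norm_num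
  have h2_t : (2 : ℝ≥0∞) < ⊤ := ENNReal.ofNat_lt_top
  have h32_1 : (1 : ℝ≥0∞) < 3 / 2 := by
    rw [ENNReal.lt_div_iff_mul_lt (Or.inl two_ne_zero) (Or.inl ENNReal.ofNat_ne_top)]
    norm_num
  have h32_t : (3 / 2 : ℝ≥0∞) < ⊤ := ENNReal.div_lt_top ENNReal.ofNat_ne_top two_ne_zero
  have h32_2 : (3 / 2 : ℝ≥0∞) ≤ 2 := by
    rw [ENNReal.div_le_iff (by norm_num) (by norm_num)]; norm_num
  have h2_32 : 2 * (3 / 2 : ℝ≥0∞) = 3 := ENNReal.mul_div_cancel two_ne_zero ENNReal.ofNat_ne_top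
  have h32r : (3 / 2 : ℝ≥0∞).toReal = 3 / 2 := by rw [ENNReal.toReal_div]; norm_num
  -- ### constants
  obtain ⟨Cd, hCdt, hCd⟩ := exists_normalisedPressure_sub_eq_add (P := p / 2) (r₁ := 2) (r₂ := 3 / 2)
    hP1 hPt h2_1 h2_t h32_1 h32_t
  obtain ⟨Cs, hCs⟩ := exists_eLpNorm_normalisedPressure_le_sq (p := p / 2) hP1 hPt
  set KS : ℝ≥0∞ := (SNormLESNormFDerivOfEqConst (EuclideanSpace ℝ (Fin 3))
    (volume : Measure (EuclideanSpace ℝ (Fin 3))) 2 : ℝ≥0∞) with hKS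
  set vK₁ : ℝ≥0∞ := volume K ^ (2 / 3 - 1 / (2 : ℝ≥0∞).toReal : ℝ) with hvK₁
  set vK₃ : ℝ≥0∞ := volume K ^ (2 / 3 - 1 / (p / 2).toReal : ℝ) with hvK₃
  have hvK₁t : vK₁ ≠ ⊤ := ENNReal.rpow_ne_top_of_nonneg (by norm_num) hK
  have hvK₃t : vK₃ ≠ ⊤ := by
    refine ENNReal.rpow_ne_top_of_nonneg ?_ hK
    rw [sub_nonneg]
    have h1 : (3 / 2 : ℝ) ≤ (p / 2).toReal := by
      rw [← h32r]; exact ENNReal.toReal_mono hPt.ne h32P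
    calc 1 / (p / 2).toReal ≤ 1 / (3 / 2 : ℝ) := one_div_le_one_div_of_le (by norm_num) h1
      _ = 2 / 3 := by norm_num
  -- `L²`-size of `W`, `L³`-interpolation constants
  set Λe : ℝ≥0∞ := ENNReal.ofReal Λs with hΛe
  -- the three pieces' constants
  set A₁ : ℝ≥0∞ := (Cd * (ENNReal.ofReal M * Λe ^ (1 / 2 : ℝ)) * vK₁) ^ (3 / 2 : ℝ) with hA₁
  set A₂ : ℝ≥0∞ := Cd ^ (3 / 2 : ℝ) * (Λe ^ (1 / 4 : ℝ) * (Λe ^ (2 / 3 : ℝ) * KS ^ 2) ^ (3 / 4 : ℝ)) with hA₂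
  set A₃ : ℝ≥0∞ := ((Cs : ℝ≥0∞) * (NV : ℝ≥0∞) ^ 2 * vK₃) ^ (3 / 2 : ℝ) with hA₃
  have hA₁t : A₁ ≠ ⊤ := by simp only [hA₁]; finiteness
  have hA₂t : A₂ ≠ ⊤ := by simp only [hA₂]; finiteness
  have hA₃t : A₃ ≠ ⊤ := by simp only [hA₃]; finiteness
  set c3 : ℝ≥0∞ := (3 : ℝ≥0∞) ^ (3 / 2 : ℝ) with hc3
  have hc3t : c3 ≠ ⊤ := by simp only [hc3]; finiteness
  refine ⟨c3 * (A₁ + A₃), c3 * A₂, by finiteness, by finiteness, ?_⟩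
  intro a b g hac hbc hap hbp hbN hbM hWd hWi hWΛ hD hg
  set W : EuclideanSpace ℝ (Fin 3) → EuclideanSpace ℝ (Fin 3) := fun y => a y - b y with hW
  set D : ℝ≥0∞ := ∫⁻ y, ENNReal.ofReal (frobeniusNormSq (fderiv ℝ W y)) with hDdef
  have ham : AEStronglyMeasurable a volume := hac.aestronglyMeasurable
  have hbm : AEStronglyMeasurable b volume := hbc.aestronglyMeasurable
  have hWc : Continuous W := hac.sub hbc
  have hWm : AEStronglyMeasurable W volume := hWc.aestronglyMeasurable
  -- ### `W ∈ L²`, `∫ ‖W‖ₑ² ≤ Λe`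
  have hW2 : MemLp W 2 volume := (memLp_two_iff_integrable_sq_norm hWm).2 hWi
  have hW2e : ∫⁻ y, ‖W y‖ₑ ^ 2 ≤ Λe := by
    rw [lintegral_enorm_sq_eq_ofReal hWi]; exact ENNReal.ofReal_le_ofReal hWΛ
  have hW2e' : ∫⁻ y, ‖W y‖ₑ ^ (2 : ℝ) ≤ Λe := by
    simpa only [ENNReal.rpow_two] using hW2e
  -- ### `∫ ‖W‖ₑ^{10/3} ≤ Λe^{2/3} KS² D`
  have h103 : ∫⁻ y, ‖W y‖ₑ ^ (10 / 3 : ℝ) ≤ Λe ^ (2 / 3 : ℝ) * (KS ^ 2 * D) := by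
    refine (lintegral_tenThirds_le hWd hW2).trans ?_
    gcongr
  -- ### `∫ ‖W‖ₑ³ ≤ Λe^{1/4} (Λe^{2/3} KS² D)^{3/4}`
  have h3 : ∫⁻ y, ‖W y‖ₑ ^ (3 : ℝ) ≤ Λe ^ (1 / 4 : ℝ) * (Λe ^ (2 / 3 : ℝ) * (KS ^ 2 * D)) ^ (3 / 4 : ℝ) := by
    refine (lintegral_rpow_three_le_interpolation volume hWm.enorm).trans ?_
    gcongr
  have h3top : ∫⁻ y, ‖W y‖ₑ ^ (3 : ℝ) < ⊤ := by
    refine lt_of_le_of_lt h3 ?_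
    have hDt : D ≠ ⊤ := hD.ne
    simp only [hKS, hΛe]
    finiteness
  -- ### `|W|² ∈ L^{3/2}` with `‖|W|²‖_{3/2}^{3/2} = ∫ ‖W‖ₑ³`
  have hW3 : MemLp W 3 volume := by
    refine ⟨hWm, ?_⟩
    have e := lintegral_enorm_rpow_toReal_eq (μ := volume) W (p := 3) (by norm_num) (by finiteness)
    rw [ENNReal.toReal_ofNat] at e
    by_contra htop
    rw [not_lt, top_le_iff] at htop
    rw [htop, ENNReal.top_rpow_of_pos (by norm_num)] at e
    exact h3top.ne e
  have hcc : MemLp (fun y => ‖a y - b y‖ * ‖a y - b y‖) (3 / 2) volume := by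
    have h1 : MemLp (fun y => ‖W y‖ ^ 2) (3 / 2) volume := by
      refine memLp_norm_sq_of_memLp_two_mul ?_
      rw [h2_32]; exact hW3
    have e : (fun y => ‖a y - b y‖ * ‖a y - b y‖) = fun y => ‖W y‖ ^ 2 := by
      funext y; simp only [hW]; ring
    rw [e]; exact h1
  have hcb : MemLp (fun y => ‖a y - b y‖ * ‖b y‖) 2 volume := by
    refine (hW2.norm.const_mul M).of_le (hWm.norm.mul hbm.norm) (Eventually.of_forall fun y => ?_)
    rw [Real.norm_eq_abs, Real.norm_eq_abs, abs_of_nonneg (by positivity), abs_of_nonneg (by positivity)]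
    calc ‖a y - b y‖ * ‖b y‖ ≤ ‖a y - b y‖ * M := mul_le_mul_of_nonneg_left (hbM y) (norm_nonneg _)
      _ = M * ‖W y‖ := by simp only [hW]; ring
  have ha2 : MemLp (fun y => ‖a y‖ ^ 2) (p / 2) volume :=
    memLp_norm_sq_of_memLp_two_mul (by rw [h2P]; exact hap)
  have hb2 : MemLp (fun y => ‖b y‖ ^ 2) (p / 2) volume :=
    memLp_norm_sq_of_memLp_two_mul (by rw [h2P]; exact hbp)
  obtain ⟨Q₁, Q₂, hQ₁m, hQ₂m, hQeq, hQ₁b, hQ₂b⟩ := hCd a b ham hbm ha2 hb2 hcb hcc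
  -- the pressure of `b`
  have hpbm : AEStronglyMeasurable (normalisedPressure b) volume :=
    aestronglyMeasurable_normalisedPressure_of_sq hP1 hPt hbm hb2
  have hpb : eLpNorm (normalisedPressure b) (p / 2) volume ≤ Cs * (NV : ℝ≥0∞) ^ 2 := by
    have hbp' : MemLp b (2 * (p / 2)) volume := by rw [h2P]; exact hbp
    refine (hCs b hbp').trans (mul_le_mul' le_rfl ?_)
    rw [h2P]
    exact pow_le_pow_left' hbN 2
  -- ### the three pieces on `K`
  -- piece 1: `Q₁ ∈ L²`
  have hWnorm : eLpNorm W 2 volume ≤ Λe ^ (1 / 2 : ℝ) := by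
    rw [eLpNorm_eq_lintegral_rpow_enorm_toReal (by norm_num) (by norm_num), ENNReal.toReal_ofNat]
    exact ENNReal.rpow_le_rpow hW2e' (by norm_num)
  have hprod1 : eLpNorm (fun y => ‖a y - b y‖ * ‖b y‖) 2 volume ≤ ENNReal.ofReal M * Λe ^ (1 / 2 : ℝ) := by
    calc eLpNorm (fun y => ‖a y - b y‖ * ‖b y‖) 2 volume ≤ eLpNorm (fun y => M * ‖W y‖) 2 volume := by
          refine eLpNorm_mono_real fun y => ?_
          rw [Real.norm_eq_abs, abs_of_nonneg (by positivity)]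
          calc ‖a y - b y‖ * ‖b y‖ ≤ ‖a y - b y‖ * M := mul_le_mul_of_nonneg_left (hbM y) (norm_nonneg _)
            _ = M * ‖W y‖ := by simp only [hW]; ring
      _ = ENNReal.ofReal M * eLpNorm W 2 volume := by
          have e : (fun y => M * ‖W y‖) = M • fun y => ‖W y‖ := by funext y; simp [smul_eq_mul]
          rw [e, eLpNorm_const_smul, eLpNorm_norm, Real.enorm_eq_ofReal hM]
      _ ≤ ENNReal.ofReal M * Λe ^ (1 / 2 : ℝ) := mul_le_mul' le_rfl hWnorm
  have hpiece1 : ∫⁻ x in K, ‖Q₁ x‖ₑ ^ (3 / 2 : ℝ) ≤ A₁ := by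
    refine (setLIntegral_rpow_threeHalves_le hQ₁m h32_2).trans ?_
    simp only [hA₁]
    refine ENNReal.rpow_le_rpow ?_ (by norm_num)
    refine mul_le_mul' (hQ₁b.trans (mul_le_mul' le_rfl hprod1)) le_rfl
  -- piece 2: `Q₂ ∈ L^{3/2}` with `‖Q₂‖_{3/2}^{3/2} ≤ Cd^{3/2} ∫ ‖W‖ₑ³`
  have hpiece2 : ∫⁻ x in K, ‖Q₂ x‖ₑ ^ (3 / 2 : ℝ) ≤ A₂ * (1 + D) := by
    have h1 : ∫⁻ x in K, ‖Q₂ x‖ₑ ^ (3 / 2 : ℝ) ≤ ∫⁻ x, ‖Q₂ x‖ₑ ^ (3 / 2 : ℝ) :=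
      setLIntegral_le_lintegral _ _
    have h2 : ∫⁻ x, ‖Q₂ x‖ₑ ^ (3 / 2 : ℝ) = eLpNorm Q₂ (3 / 2) volume ^ (3 / 2 : ℝ) := by
      have e := lintegral_enorm_rpow_toReal_eq (μ := volume) Q₂ (p := 3 / 2) (by norm_num) h32_t.ne
      rwa [h32r] at e
    have h3' : eLpNorm (fun y => ‖a y - b y‖ * ‖a y - b y‖) (3 / 2) volume ^ (3 / 2 : ℝ) =
        ∫⁻ y, ‖W y‖ₑ ^ (3 : ℝ) := by
      have e := lintegral_enorm_rpow_toReal_eq (μ := volume) (fun y => ‖a y - b y‖ * ‖a y - b y‖)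
        (p := 3 / 2) (by norm_num) h32_t.ne
      rw [h32r] at e
      rw [← e]
      refine lintegral_congr fun y => ?_
      have hn : ‖‖a y - b y‖ * ‖a y - b y‖‖ₑ = ‖W y‖ₑ ^ (2 : ℝ) := by
        rw [Real.enorm_eq_ofReal (by positivity), show ‖a y - b y‖ * ‖a y - b y‖ = ‖W y‖ ^ 2 by
          simp only [hW]; ring, ENNReal.rpow_two, ← ofReal_norm, ENNReal.ofReal_pow (norm_nonneg _)]
      rw [hn, ← ENNReal.rpow_mul]
      norm_num
    calc ∫⁻ x in K, ‖Q₂ x‖ₑ ^ (3 / 2 : ℝ) ≤ eLpNorm Q₂ (3 / 2) volume ^ (3 / 2 : ℝ) := h1.trans h2.le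
      _ ≤ (Cd * eLpNorm (fun y => ‖a y - b y‖ * ‖a y - b y‖) (3 / 2) volume) ^ (3 / 2 : ℝ) :=
          ENNReal.rpow_le_rpow hQ₂b (by norm_num)
      _ = Cd ^ (3 / 2 : ℝ) * ∫⁻ y, ‖W y‖ₑ ^ (3 : ℝ) := by
          rw [ENNReal.mul_rpow_of_nonneg _ _ (by norm_num), h3']
      _ ≤ Cd ^ (3 / 2 : ℝ) * (Λe ^ (1 / 4 : ℝ) * (Λe ^ (2 / 3 : ℝ) * (KS ^ 2 * D)) ^ (3 / 4 : ℝ)) :=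
          mul_le_mul' le_rfl h3
      _ = A₂ * D ^ (3 / 4 : ℝ) := by
          simp only [hA₂]
          rw [show Λe ^ (2 / 3 : ℝ) * (KS ^ 2 * D) = (Λe ^ (2 / 3 : ℝ) * KS ^ 2) * D by ring,
            ENNReal.mul_rpow_of_nonneg _ D (by norm_num)]
          ring
      _ ≤ A₂ * (1 + D) := by
          refine mul_le_mul' le_rfl ?_
          rcases le_or_gt D 1 with hle | hgt
          · exact (ENNReal.rpow_le_one hle (by norm_num)).trans le_self_add
          · exact ((ENNReal.rpow_le_rpow_of_exponent_le hgt.le (by norm_num : (3 / 4 : ℝ) ≤ 1)).trans_eq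
              (ENNReal.rpow_one D)).trans le_add_self
  -- piece 3: `p̃[b] ∈ L^{p/2}`
  have hpiece3 : ∫⁻ x in K, ‖normalisedPressure b x‖ₑ ^ (3 / 2 : ℝ) ≤ A₃ := by
    refine (setLIntegral_rpow_threeHalves_le hpbm h32P).trans ?_
    simp only [hA₃]
    exact ENNReal.rpow_le_rpow (mul_le_mul' hpb le_rfl) (by norm_num)
  -- ### assembly: `g = Q₁ + Q₂ + p̃[b]` a.e.
  have hgae : g =ᵐ[volume] fun x => Q₁ x + Q₂ x + normalisedPressure b x := by
    filter_upwards [hg, hQeq] with x hx hxQ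
    have hxQ' : normalisedPressure a x - normalisedPressure b x = Q₁ x + Q₂ x := hxQ
    rw [hx]; linarith
  have hmeas1 : AEMeasurable (fun x => ‖Q₁ x‖ₑ ^ (3 / 2 : ℝ)) (volume.restrict K) :=
    (hQ₁m.restrict.enorm.pow_const _)
  have hmeas2 : AEMeasurable (fun x => ‖Q₂ x‖ₑ ^ (3 / 2 : ℝ)) (volume.restrict K) :=
    (hQ₂m.restrict.enorm.pow_const _)
  have hmeas12 : AEMeasurable (fun x => ‖Q₁ x‖ₑ ^ (3 / 2 : ℝ) + ‖Q₂ x‖ₑ ^ (3 / 2 : ℝ))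
      (volume.restrict K) := hmeas1.add hmeas2
  calc ∫⁻ x in K, ‖g x‖ₑ ^ (3 / 2 : ℝ)
      = ∫⁻ x in K, ‖Q₁ x + Q₂ x + normalisedPressure b x‖ₑ ^ (3 / 2 : ℝ) :=
        lintegral_congr_ae ((ae_restrict_of_ae hgae).mono fun x hx => by
          show ‖g x‖ₑ ^ (3 / 2 : ℝ) = ‖Q₁ x + Q₂ x + normalisedPressure b x‖ₑ ^ (3 / 2 : ℝ)
          rw [hx])
    _ ≤ ∫⁻ x in K, c3 * (‖Q₁ x‖ₑ ^ (3 / 2 : ℝ) + ‖Q₂ x‖ₑ ^ (3 / 2 : ℝ) +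
          ‖normalisedPressure b x‖ₑ ^ (3 / 2 : ℝ)) := by
        refine lintegral_mono fun x => ?_
        calc ‖Q₁ x + Q₂ x + normalisedPressure b x‖ₑ ^ (3 / 2 : ℝ)
            ≤ (‖Q₁ x‖ₑ + ‖Q₂ x‖ₑ + ‖normalisedPressure b x‖ₑ) ^ (3 / 2 : ℝ) := by
              refine ENNReal.rpow_le_rpow ?_ (by norm_num)
              exact (enorm_add_le _ _).trans (add_le_add (enorm_add_le _ _) le_rfl)
          _ ≤ _ := add_add_rpow_le_three_rpow_mul _ _ _ (by norm_num)
    _ = c3 * ((∫⁻ x in K, ‖Q₁ x‖ₑ ^ (3 / 2 : ℝ)) + (∫⁻ x in K, ‖Q₂ x‖ₑ ^ (3 / 2 : ℝ)) +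
          ∫⁻ x in K, ‖normalisedPressure b x‖ₑ ^ (3 / 2 : ℝ)) := by
        rw [lintegral_const_mul' _ _ hc3t, lintegral_add_left' hmeas12, lintegral_add_left' hmeas1]
    _ ≤ c3 * (A₁ + A₂ * (1 + D) + A₃) := by gcongr
    _ = c3 * (A₁ + A₃) + c3 * A₂ * (1 + D) := by ring


/-- **Members of Albritton's class are local Leray solutions on the full remaining slab**
(Albritton 2018, proof of Prop. 4.5: the Calderón splitting `u = U + V` with
`U ∈ L^∞_t L²_x ∩ L²_t Ḣ¹_x` up to `T*` and `V` smooth and bounded, so that "one may justify the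
local energy inequality for `(u, p)`" on `ℝ³ × ]T₁, T*[`; Lemarié-Rieusset 2016, Def. 14.1). Given
the objects of `AlbrittonRemainderSetup.exists_calderon_remainder` for a member `u` of the class
and `t₀ ∈ (0, T)`, the classical representative `v` of `u(· + t₀)` is a local Leray solution on
`(0, T − t₀) × ℝ³` with datum `u(t₀)`, for the gauged pressure `π − c(t)`
(`exists_continuous_gauge`). Clauses: suitability of classical solutions and gauge invariance
(`IsSuitableWeakSolutionOn.sub_pressure`); `|v|² ≤ 2|W|² + 2|V|²` with `W ∈ L^∞L²`, `V`
bounded; the pressure `p̃[v] = Q₁ + Q₂ + p̃[V]`, `Q₁ ∈ L^∞L²`, `Q₂ ∈ L^{5/3}` by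
`W ∈ L^{10/3}` (Sobolev and interpolation), `p̃[V] ∈ L^∞L^{p/2}`; the gradient from the bound
near `t = 0` and `|∇v|² ≤ 2|∇W|² + 2|∇V|²` away from it; the datum from `u ∈ C([0,T); L^p)`;
the decay from the tails of `W ∈ L²` and `V ∈ L^p` of the strip.
[cite: Albritton2018, Prop. 4.5 proof ((4.32)–(4.36)); LemarieRieusset2016 Def. 14.1] -/
theorem isLocalLeraySolutionOn_full (hp₃ : 3 < p) (hp : p < ⊤) (hT : 0 < T)
    (h : IsKatoBesovMildSolutionOn p q T 1 u U) {t₀ : ℝ} (ht₀ : t₀ ∈ Ioo 0 T)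
    {v V : ℝ → EuclideanSpace ℝ (Fin 3) → EuclideanSpace ℝ (Fin 3)}
    {π πV : ℝ → EuclideanSpace ℝ (Fin 3) → ℝ} {L M Λ₀ : ℝ}
    (hvcl : IsClassicalNSSolutionOn (Ioo (-(t₀ / 2)) (T - t₀)) 1 0 v π)
    (hvu : ∀ t ∈ Ico 0 (T - t₀), v t =ᵐ[volume] u (t + t₀))
    (hgrads : ∀ S₁, S₁ < T - t₀ → ∃ K : ℝ, ∀ t ∈ Icc 0 S₁, ∀ x, ‖fderiv ℝ (v t) x‖ ≤ K)
    (hLpb : ∀ S₁, S₁ < T - t₀ → ∃ N : ℝ≥0, ∀ t ∈ Ioo 0 S₁, MemLp (v t) p volume ∧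
      eLpNorm (v t) p volume ≤ N)
    (hSL : T - t₀ < L) (hM : 0 < M) (hVcl : IsClassicalNSSolutionOn (Ioo 0 L) 1 0 V πV)
    (hVbd : ∀ t ∈ Ioo 0 L, ∀ x, ‖V t x‖ ≤ M)
    (hVp : ∃ N : ℝ≥0, ∀ t ∈ Ioo 0 L, MemLp (V t) p volume ∧ eLpNorm (V t) p volume ≤ N)
    (hVgrad : ∃ C : ℝ, ∀ t ∈ Ioo 0 L, ∀ x, t ^ (1 / 2 : ℝ) * ‖fderiv ℝ (V t) x‖ ≤ C)
    (hWL2 : ∀ t ∈ Ioo 0 (T - t₀), Integrable (fun x => ‖v t x - V t x‖ ^ 2) volume ∧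
      ∫ x, ‖v t x - V t x‖ ^ 2 ≤ 4 * Λ₀ ^ 2 * Real.exp (M ^ 2 * t))
    (hWdiss : ∀ t₁ ∈ Ioo 0 (T - t₀), ∫⁻ z in Ioo t₁ (T - t₀) ×ˢ (univ : Set (EuclideanSpace ℝ (Fin 3))),
        ENNReal.ofReal (frobeniusNormSq (fderiv ℝ (fun y => v z.1 y - V z.1 y) z.2)) ≤
      ENNReal.ofReal (4 * Λ₀ ^ 2 * (1 + M ^ 2 * (T - t₀)) * Real.exp (M ^ 2 * (T - t₀)))) :
    ∃ π' : ℝ → EuclideanSpace ℝ (Fin 3) → ℝ, IsLocalLeraySolutionOn (T - t₀) 1 (u t₀) v π' := by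
  have hp0 : p ≠ 0 := (zero_lt_three.trans hp₃).ne'
  have hptop : p ≠ ⊤ := hp.ne
  have h2p : (2 : ℝ≥0∞) ≤ p := le_trans (by norm_num) hp₃.le
  have hr3 : 3 < p.toReal := by
    have := (ENNReal.toReal_lt_toReal (by norm_num) hptop).2 hp₃
    simpa using this
  have hr0 : 0 < p.toReal := by linarith
  set S : ℝ := T - t₀ with hSdef
  have hS : 0 < S := by rw [hSdef]; linarith [ht₀.2]
  set O : Set ℝ := Ioo (-(t₀ / 2)) (T - t₀) with hO_def
  have hvcont : ContinuousOn (uncurry v) (O ×ˢ univ) := hvcl.smooth_velocity.continuousOn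
  have hVcont : ContinuousOn (uncurry V) (Ioo 0 L ×ˢ univ) := hVcl.smooth_velocity.continuousOn
  have hQ : ((slab (EuclideanSpace ℝ (Fin 3)) (Ioo 0 S) isOpen_Ioo :
      TopologicalSpace.Opens (ℝ × (EuclideanSpace ℝ (Fin 3)))) : Set (ℝ × (EuclideanSpace ℝ (Fin 3)))) ⊆ O ×ˢ univ := by
    intro z hz
    have hz1 := (mem_slab.1 hz)
    exact ⟨⟨by linarith [hz1.1, ht₀.1], hz1.2⟩, mem_univ _⟩
  have hIooO : Ioo (0 : ℝ) S ⊆ O := fun t ht => ⟨by linarith [ht.1, ht₀.1], ht.2⟩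
  have hIooL : Ioo (0 : ℝ) S ⊆ Ioo 0 L := fun t ht => ⟨ht.1, ht.2.trans hSL⟩
  have hstripO : Ioo (0 : ℝ) S ×ˢ (univ : Set (EuclideanSpace ℝ (Fin 3))) ⊆ O ×ˢ univ := prod_mono hIooO Subset.rfl
  have hstripL : Ioo (0 : ℝ) S ×ˢ (univ : Set (EuclideanSpace ℝ (Fin 3))) ⊆ Ioo 0 L ×ˢ univ := prod_mono hIooL Subset.rfl
  have hvmeas : AEStronglyMeasurable (uncurry v)
      (volume.restrict (Ioo (0 : ℝ) S ×ˢ (univ : Set (EuclideanSpace ℝ (Fin 3))))) :=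
    (hvcont.mono hstripO).aestronglyMeasurable (measurableSet_Ioo.prod MeasurableSet.univ)
  have hVmeas : AEStronglyMeasurable (uncurry V)
      (volume.restrict (Ioo (0 : ℝ) S ×ˢ (univ : Set (EuclideanSpace ℝ (Fin 3))))) :=
    (hVcont.mono hstripL).aestronglyMeasurable (measurableSet_Ioo.prod MeasurableSet.univ)
  obtain ⟨NV, hNV⟩ := hVp
  have hvmemS : ∀ t ∈ Ioo 0 S, MemLp (v t) p volume := by
    intro t ht
    obtain ⟨N, hN⟩ := hLpb ((t + S) / 2) (by linarith [ht.2])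
    exact (hN t ⟨ht.1, by linarith [ht.2]⟩).1
  -- the uniform `L²` bound of `W = v - V`
  set Λs : ℝ := 4 * Λ₀ ^ 2 * Real.exp (M ^ 2 * S) with hΛs
  have hΛs0 : 0 ≤ Λs := by positivity
  have hW2 : ∀ t ∈ Ioo 0 S, ∫ x, ‖v t x - V t x‖ ^ 2 ≤ Λs := by
    intro t ht
    refine (hWL2 t ht).2.trans ?_
    rw [hΛs]
    gcongr
    exact ht.2.le
  have hW2e : ∀ t ∈ Ioo 0 S, ∫⁻ x, ‖v t x - V t x‖ₑ ^ 2 ≤ ENNReal.ofReal Λs := by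
    intro t ht
    rw [lintegral_enorm_sq_eq_ofReal (hWL2 t ht).1]
    exact ENNReal.ofReal_le_ofReal (hW2 t ht)
  -- the strip integral of `|W|²`
  have hWstrip : ∫⁻ z in Ioo 0 S ×ˢ (univ : Set (EuclideanSpace ℝ (Fin 3))), ‖v z.1 z.2 - V z.1 z.2‖ₑ ^ 2 ≤
      ENNReal.ofReal Λs * volume (Ioo (0 : ℝ) S) := by
    rw [volume_restrict_prod_univ_eq_prod]
    calc ∫⁻ z, ‖v z.1 z.2 - V z.1 z.2‖ₑ ^ 2 ∂((volume.restrict (Ioo 0 S)).prod volume)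
        ≤ ∫⁻ t in Ioo 0 S, ∫⁻ x, ‖v t x - V t x‖ₑ ^ 2 :=
          lintegral_prod_le (μ := volume.restrict (Ioo 0 S)) (ν := (volume : Measure (EuclideanSpace ℝ (Fin 3))))
            (fun z : ℝ × (EuclideanSpace ℝ (Fin 3)) => ‖v z.1 z.2 - V z.1 z.2‖ₑ ^ 2)
      _ ≤ ∫⁻ _ in Ioo 0 S, ENNReal.ofReal Λs :=
          lintegral_mono_ae ((ae_restrict_mem measurableSet_Ioo).mono fun t ht => hW2e t ht)
      _ = ENNReal.ofReal Λs * volume (Ioo (0 : ℝ) S) := by rw [setLIntegral_const]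
  have hWstrip_top : ∫⁻ z in Ioo 0 S ×ˢ (univ : Set (EuclideanSpace ℝ (Fin 3))), ‖v z.1 z.2 - V z.1 z.2‖ₑ ^ 2 ≠ ⊤ :=
    ne_top_of_le_ne_top (ENNReal.mul_ne_top ENNReal.ofReal_ne_top measure_Ioo_lt_top.ne) hWstrip
  -- the dissipation from time `0`
  set Dtot : ℝ := 4 * Λ₀ ^ 2 * (1 + M ^ 2 * S) * Real.exp (M ^ 2 * S) with hDtot
  have hWdiss0 : ∫⁻ z in Ioo 0 S ×ˢ (univ : Set (EuclideanSpace ℝ (Fin 3))),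
      ENNReal.ofReal (frobeniusNormSq (fderiv ℝ (fun y => v z.1 y - V z.1 y) z.2)) ≤ ENNReal.ofReal Dtot := by
    set tn : ℕ → ℝ := fun n => S / ((n : ℝ) + 2) with htn
    have htn_pos : ∀ n, 0 < tn n := fun n => by simp only [htn]; positivity
    have htn_lt : ∀ n, tn n < S := fun n => by
      simp only [htn]
      rw [div_lt_iff₀ (by positivity)]
      have := n.cast_nonneg (α := ℝ); nlinarith
    have hanti : Antitone tn := by
      intro m n hmn
      simp only [htn]
      exact div_le_div_of_nonneg_left hS.le (by positivity) (by exact_mod_cast Nat.add_le_add_right hmn 2)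
    have hunion : Ioo 0 S ×ˢ (univ : Set (EuclideanSpace ℝ (Fin 3))) =
        ⋃ n, Ioo (tn n) S ×ˢ (univ : Set (EuclideanSpace ℝ (Fin 3))) := by
      rw [← iUnion_prod_const]
      congr 1
      ext t
      simp only [mem_Ioo, mem_iUnion]
      constructor
      · rintro ⟨h1, h2⟩
        obtain ⟨n, hn⟩ := exists_nat_gt (S / t)
        refine ⟨n, ?_, h2⟩
        simp only [htn]
        rw [div_lt_iff₀ (by positivity)]
        rw [div_lt_iff₀ h1] at hn
        nlinarith
      · rintro ⟨n, h1, h2⟩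
        exact ⟨(htn_pos n).trans h1, h2⟩
    have hdir : Directed (· ⊆ ·) fun n => Ioo (tn n) S ×ˢ (univ : Set (EuclideanSpace ℝ (Fin 3))) :=
      Monotone.directed_le fun m n hmn => prod_mono (Ioo_subset_Ioo_left (hanti hmn)) Subset.rfl
    rw [hunion, setLIntegral_iUnion_of_directed _ hdir]
    exact iSup_le fun n => hWdiss (tn n) ⟨htn_pos n, htn_lt n⟩
  -- ### the gauge
  obtain ⟨cg, hcgc, hcg⟩ := exists_continuous_gauge hp₃ hp hT h ht₀ hvcl hvu hLpb
  set π' : ℝ → EuclideanSpace ℝ (Fin 3) → ℝ := fun t x => π t x - cg t with hπ'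
  refine ⟨π', ?_, ?_, ?_, ?_, ?_, ?_, ?_⟩
  · -- ### (1)+(4) suitability: classical solutions are suitable; gauge invariance
    have hsw : IsSuitableWeakSolutionOn (slab (EuclideanSpace ℝ (Fin 3)) (Ioo 0 S) isOpen_Ioo) 1 0 v π := by
      refine isSuitableWeakSolutionOn_of_contDiffOn (isOpen_Ioo) hQ
        (hvcl.smooth_velocity.of_le (by norm_cast)) (hvcl.smooth_pressure.of_le (by norm_cast))
        continuousOn_const (fun t ht x => ?_) hvcl.divFree
      have hm := hvcl.momentum t ht x
      rwa [timeDerivWithin_apply, derivWithin_of_isOpen isOpen_Ioo ht, ← timeDeriv_apply] at hm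
    have hcgslab : ContinuousOn (fun z : ℝ × EuclideanSpace ℝ (Fin 3) => cg z.1)
        ((slab (EuclideanSpace ℝ (Fin 3)) (Ioo 0 S) isOpen_Ioo : TopologicalSpace.Opens (ℝ × (EuclideanSpace ℝ (Fin 3)))) :
          Set (ℝ × (EuclideanSpace ℝ (Fin 3)))) :=
      hcgc.comp continuousOn_fst fun z hz => mem_slab.1 hz
    refine hsw.sub_pressure (c := cg) ?_ ?_
    · exact hcgslab.locallyIntegrableOn (TopologicalSpace.Opens.isOpen _).measurableSet
    · intro K hK hKc
      obtain ⟨B, hB⟩ := hKc.exists_bound_of_continuousOn (hcgslab.mono hK)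
      calc ∫⁻ z in K, ‖cg z.1‖ₑ ^ (3 / 2 : ℝ) ≤ ∫⁻ _ in K, ENNReal.ofReal B ^ (3 / 2 : ℝ) := by
            refine setLIntegral_mono measurable_const fun z hz => ?_
            refine ENNReal.rpow_le_rpow ?_ (by norm_num)
            rw [← ofReal_norm]
            exact ENNReal.ofReal_le_ofReal (hB z hz)
        _ < ⊤ := by
            rw [setLIntegral_const]
            exact ENNReal.mul_lt_top (ENNReal.rpow_lt_top_of_nonneg (by norm_num) ENNReal.ofReal_ne_top)
              hKc.measure_lt_top
  · -- ### `v ∈ L²((0,S) × K)`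
    intro K hK
    have hKvol : volume (Ioo (0 : ℝ) S ×ˢ K) < ⊤ := by
      rw [show (volume : Measure (ℝ × (EuclideanSpace ℝ (Fin 3)))) =
        (volume : Measure ℝ).prod (volume : Measure (EuclideanSpace ℝ (Fin 3))) from rfl, Measure.prod_prod]
      exact ENNReal.mul_lt_top measure_Ioo_lt_top hK.measure_lt_top
    calc ∫⁻ z in Ioo 0 S ×ˢ K, ‖v z.1 z.2‖ₑ ^ 2
        ≤ ∫⁻ z in Ioo 0 S ×ˢ K, (2 * ‖v z.1 z.2 - V z.1 z.2‖ₑ ^ 2 + 2 * ‖V z.1 z.2‖ₑ ^ 2) :=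
          lintegral_mono fun z => enorm_sq_le_two_mul _ _
      _ ≤ ∫⁻ z in Ioo 0 S ×ˢ K, (2 * ‖v z.1 z.2 - V z.1 z.2‖ₑ ^ 2 + 2 * ENNReal.ofReal M ^ 2) := by
          refine setLIntegral_mono' (measurableSet_Ioo.prod hK.measurableSet) fun z hz => ?_
          gcongr
          rw [← ofReal_norm]
          exact ENNReal.ofReal_le_ofReal (hVbd z.1 (hIooL hz.1) z.2)
      _ = 2 * (∫⁻ z in Ioo 0 S ×ˢ K, ‖v z.1 z.2 - V z.1 z.2‖ₑ ^ 2) +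
            2 * ENNReal.ofReal M ^ 2 * volume (Ioo (0 : ℝ) S ×ˢ K) := by
          rw [lintegral_add_right _ measurable_const, lintegral_const_mul' _ _ ENNReal.ofNat_ne_top,
            setLIntegral_const]
      _ < ⊤ := by
          refine ENNReal.add_lt_top.2 ⟨ENNReal.mul_lt_top (by simp) ?_, ?_⟩
          · exact lt_of_le_of_lt (lintegral_mono_set (prod_mono Subset.rfl (subset_univ _))) hWstrip_top.lt_top
          · exact ENNReal.mul_lt_top (ENNReal.mul_lt_top (by simp) (ENNReal.pow_lt_top ENNReal.ofReal_lt_top)) hKvol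
  · -- ### the pressure `π' ∈ L^{3/2}((0,S) × K)`
    intro K hK
    obtain ⟨B₀, B₁, hB₀, hB₁, hslice⟩ := exists_setLIntegral_pressure_slice_le (Λs := Λs) hp₃ hp hM.le NV
      hK.measure_lt_top.ne
    -- the dissipation density, its measurability and its time integral
    set Φ : ℝ × EuclideanSpace ℝ (Fin 3) → ℝ≥0∞ := fun z =>
      ENNReal.ofReal (frobeniusNormSq (fderiv ℝ (fun y => v z.1 y - V z.1 y) z.2)) with hΦ
    have hWsm : IsSmoothSpaceTimeOn (Ioo 0 S) (fun t y => v t y - V t y) :=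
      (hvcl.smooth_velocity.mono hIooO).sub (hVcl.smooth_velocity.mono hIooL)
    have hΦc : ContinuousOn (fun z : ℝ × EuclideanSpace ℝ (Fin 3) =>
        frobeniusNormSq (fderiv ℝ (fun y => v z.1 y - V z.1 y) z.2)) (Ioo 0 S ×ˢ univ) := by
      -- elaborate the lemma first (its `w z.1` is not a higher-order pattern), then beta-reduce
      have h' := PerturbedEnergyInequality.continuousOn_frobeniusNormSq_fderiv_slice hWsm isOpen_Ioo
      exact h'
    have hprodμ : (volume.restrict (Ioo (0 : ℝ) S ×ˢ (univ : Set (EuclideanSpace ℝ (Fin 3))))) =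
        (volume.restrict (Ioo (0 : ℝ) S)).prod (volume : Measure (EuclideanSpace ℝ (Fin 3))) :=
      volume_restrict_prod_univ_eq_prod _
    have hΦm : AEMeasurable Φ ((volume.restrict (Ioo (0 : ℝ) S)).prod (volume : Measure (EuclideanSpace ℝ (Fin 3)))) := by
      rw [← hprodμ]
      exact ENNReal.measurable_ofReal.comp_aemeasurable
        (hΦc.aemeasurable (measurableSet_Ioo.prod MeasurableSet.univ))
    set D : ℝ → ℝ≥0∞ := fun t => ∫⁻ y, Φ (t, y) with hD
    have hDint : ∫⁻ t in Ioo 0 S, D t ≤ ENNReal.ofReal Dtot := by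
      rw [← lintegral_prod _ hΦm, ← hprodμ]
      exact hWdiss0
    have hDm : AEMeasurable D (volume.restrict (Ioo (0 : ℝ) S)) := hΦm.lintegral_prod_right'
    have hDae : ∀ᵐ t ∂(volume.restrict (Ioo (0 : ℝ) S)), D t < ⊤ :=
      ae_lt_top' hDm (ne_top_of_le_ne_top ENNReal.ofReal_ne_top hDint)
    -- the slice bound, a.e. in `t`
    have hsl : ∀ᵐ t ∂(volume.restrict (Ioo (0 : ℝ) S)),
        ∫⁻ x in K, ‖π' t x‖ₑ ^ (3 / 2 : ℝ) ≤ B₀ + B₁ * (1 + D t) := by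
      filter_upwards [hDae, ae_restrict_mem measurableSet_Ioo] with t hDt ht
      have htO : t ∈ O := hIooO ht
      have htL : t ∈ Ioo 0 L := hIooL ht
      have hW1 : ContDiff ℝ 1 (fun y => v t y - V t y) := contDiff_infty.1 (hWsm.contDiff_slice ht) 1
      have hae : π' t =ᵐ[volume] normalisedPressure (v t) := by
        filter_upwards [hcg t ht] with x hx
        exact hx
      exact hslice (v t) (V t) (π' t) (hvcl.contDiff_velocity htO).continuous
        (hVcl.contDiff_velocity htL).continuous (hvmemS t ht) (hNV t htL).1 (hNV t htL).2
        (fun x => hVbd t htL x) hW1 (hWL2 t ht).1 (hW2 t ht) hDt hae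
    -- integrate in `t`
    have hvolS : volume (Ioo (0 : ℝ) S) ≠ ⊤ := measure_Ioo_lt_top.ne
    calc ∫⁻ z in Ioo 0 S ×ˢ K, ‖π' z.1 z.2‖ₑ ^ (3 / 2 : ℝ)
        = ∫⁻ z, ‖π' z.1 z.2‖ₑ ^ (3 / 2 : ℝ) ∂((volume.restrict (Ioo (0 : ℝ) S)).prod (volume.restrict K)) := by
          rw [Measure.prod_restrict]; rfl
      _ ≤ ∫⁻ t in Ioo 0 S, ∫⁻ x in K, ‖π' t x‖ₑ ^ (3 / 2 : ℝ) := lintegral_prod_le _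
      _ ≤ ∫⁻ t in Ioo 0 S, (B₀ + B₁ * (1 + D t)) := lintegral_mono_ae hsl
      _ = (B₀ + B₁) * volume (Ioo (0 : ℝ) S) + B₁ * ∫⁻ t in Ioo 0 S, D t := by
          have e : ∀ t, B₀ + B₁ * (1 + D t) = (B₀ + B₁) + B₁ * D t := fun t => by ring
          simp_rw [e]
          rw [lintegral_add_left' aemeasurable_const, setLIntegral_const, lintegral_const_mul'' _ hDm]
      _ < ⊤ := by
          refine ENNReal.add_lt_top.2 ⟨ENNReal.mul_lt_top (by finiteness) measure_Ioo_lt_top,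
            ENNReal.mul_lt_top hB₁.lt_top ?_⟩
          exact lt_of_le_of_lt hDint ENNReal.ofReal_lt_top
  · -- ### uniformly local energy
    intro R hR
    have hfin : 2 * ENNReal.ofReal Λs + 2 * ENNReal.ofReal M ^ 2 * volume (ball (0 : EuclideanSpace ℝ (Fin 3)) R) ≠ ⊤ :=
      ENNReal.add_ne_top.2 ⟨ENNReal.mul_ne_top ENNReal.ofNat_ne_top ENNReal.ofReal_ne_top,
        ENNReal.mul_ne_top (ENNReal.mul_ne_top ENNReal.ofNat_ne_top (ENNReal.pow_ne_top ENNReal.ofReal_ne_top))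
          measure_ball_lt_top.ne⟩
    refine ⟨(2 * ENNReal.ofReal Λs + 2 * ENNReal.ofReal M ^ 2 * volume (ball (0 : EuclideanSpace ℝ (Fin 3)) R)).toNNReal,
      (ae_restrict_mem measurableSet_Ioo).mono fun t ht x₀ => ?_⟩
    rw [ENNReal.coe_toNNReal hfin]
    calc ∫⁻ x in ball x₀ R, ‖v t x‖ₑ ^ 2
        ≤ ∫⁻ x in ball x₀ R, (2 * ‖v t x - V t x‖ₑ ^ 2 + 2 * ENNReal.ofReal M ^ 2) := by
          refine lintegral_mono fun x => (enorm_sq_le_two_mul (v t x) (V t x)).trans ?_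
          gcongr
          rw [← ofReal_norm]
          exact ENNReal.ofReal_le_ofReal (hVbd t (hIooL ht) x)
      _ = 2 * (∫⁻ x in ball x₀ R, ‖v t x - V t x‖ₑ ^ 2) + 2 * ENNReal.ofReal M ^ 2 * volume (ball x₀ R) := by
          rw [lintegral_add_right _ measurable_const, lintegral_const_mul' _ _ ENNReal.ofNat_ne_top,
            setLIntegral_const]
      _ ≤ 2 * ENNReal.ofReal Λs + 2 * ENNReal.ofReal M ^ 2 * volume (ball (0 : EuclideanSpace ℝ (Fin 3)) R) := by
          rw [Measure.addHaar_ball_center]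
          gcongr
          exact (lintegral_mono_set (subset_univ _) |>.trans (by rw [Measure.restrict_univ]; exact hW2e t ht))
  · -- ### uniformly local gradient
    refine ⟨fun t x => fderiv ℝ (v t) x,
      hasWeakSpatialGradientOn_of_contDiffOn isOpen_Ioo hQ (hvcl.smooth_velocity.of_le (by norm_cast)),
      fun R hR => ?_⟩
    -- the split time `δ = S/2`: bounded gradient before, `∇v = ∇W + ∇V` after
    set δ : ℝ := S / 2 with hδ
    have hδ0 : 0 < δ := by rw [hδ]; positivity
    have hδS : δ < S := by rw [hδ]; linarith
    obtain ⟨K₁, hK₁⟩ := hgrads δ hδS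
    obtain ⟨CV, hCV⟩ := hVgrad
    set c₁ : ℝ≥0∞ := ENNReal.ofReal (3 * K₁ ^ 2) with hc₁
    set c₂ : ℝ≥0∞ := ENNReal.ofReal (6 * (CV ^ 2 / δ)) with hc₂
    set vol : ℝ≥0∞ := volume (Ioo (0 : ℝ) S) * volume (ball (0 : EuclideanSpace ℝ (Fin 3)) R) with hvol
    have hvolt : vol ≠ ⊤ := ENNReal.mul_ne_top measure_Ioo_lt_top.ne measure_ball_lt_top.ne
    have hfin : c₁ * vol + (2 * ENNReal.ofReal Dtot + c₂ * vol) ≠ ⊤ := by finiteness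
    refine ⟨(c₁ * vol + (2 * ENNReal.ofReal Dtot + c₂ * vol)).toNNReal, fun x₀ => ?_⟩
    rw [ENNReal.coe_toNNReal hfin]
    set F : ℝ × EuclideanSpace ℝ (Fin 3) → ℝ≥0∞ := fun z => ENNReal.ofReal (frobeniusNormSq (fderiv ℝ (v z.1) z.2)) with hF
    -- the two time pieces
    have hsplit : Ioo (0 : ℝ) S ×ˢ ball x₀ R ⊆ Ioc (0 : ℝ) δ ×ˢ ball x₀ R ∪ Ioo δ S ×ˢ ball x₀ R := by
      rintro ⟨t, x⟩ ⟨ht, hx⟩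
      rcases le_or_gt t δ with h1 | h1
      · exact Or.inl ⟨⟨ht.1, h1⟩, hx⟩
      · exact Or.inr ⟨⟨h1, ht.2⟩, hx⟩
    have hvol1 : volume (Ioc (0 : ℝ) δ ×ˢ ball x₀ R) ≤ vol := by
      rw [hvol, ← volume_Ioo_prod_ball S R x₀]
      exact measure_mono (prod_mono (fun t ht => ⟨ht.1, lt_of_le_of_lt ht.2 hδS⟩) Subset.rfl)
    have hvol2 : volume (Ioo δ S ×ˢ ball x₀ R) ≤ vol := by
      rw [hvol, ← volume_Ioo_prod_ball S R x₀]
      exact measure_mono (prod_mono (Ioo_subset_Ioo_left hδ0.le) Subset.rfl)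
    -- piece 1: `t ≤ δ`, `|∇v|² ≤ 3K₁²`
    have hP1 : ∫⁻ z in Ioc (0 : ℝ) δ ×ˢ ball x₀ R, F z ≤ c₁ * vol := by
      calc ∫⁻ z in Ioc (0 : ℝ) δ ×ˢ ball x₀ R, F z ≤ ∫⁻ _ in Ioc (0 : ℝ) δ ×ˢ ball x₀ R, c₁ := by
            refine setLIntegral_mono measurable_const fun z hz => ?_
            simp only [hF, hc₁]
            refine ENNReal.ofReal_le_ofReal ((frobeniusNormSq_le_three_mul_norm_sq _).trans ?_)
            have h1 := hK₁ z.1 ⟨hz.1.1.le, hz.1.2⟩ z.2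
            have h0 : 0 ≤ ‖fderiv ℝ (v z.1) z.2‖ := norm_nonneg _
            nlinarith
        _ ≤ c₁ * vol := by rw [setLIntegral_const]; exact mul_le_mul' le_rfl hvol1
    -- piece 2: `t > δ`, `|∇v|² ≤ 2|∇W|² + 2|∇V|²`, `|∇V|² ≤ 3 CV²/δ`
    have hP2 : ∫⁻ z in Ioo δ S ×ˢ ball x₀ R, F z ≤ 2 * ENNReal.ofReal Dtot + c₂ * vol := by
      have hptw : ∀ z ∈ Ioo δ S ×ˢ ball x₀ R, F z ≤
          2 * ENNReal.ofReal (frobeniusNormSq (fderiv ℝ (fun y => v z.1 y - V z.1 y) z.2)) + c₂ := by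
        rintro ⟨t, x⟩ ⟨ht, -⟩
        have htS : t ∈ Ioo 0 S := ⟨hδ0.trans ht.1, ht.2⟩
        have htL : t ∈ Ioo 0 L := hIooL htS
        have hdv : DifferentiableAt ℝ (v t) x := ((hvcl.contDiff_velocity (hIooO htS)).differentiable (by simp)) x
        have hdV : DifferentiableAt ℝ (V t) x := ((hVcl.contDiff_velocity htL).differentiable (by simp)) x
        have hsub : fderiv ℝ (fun y => v t y - V t y) x = fderiv ℝ (v t) x - fderiv ℝ (V t) x :=
          fderiv_fun_sub hdv hdV
        simp only [hF]
        have hfrob := frobeniusNormSq_le_two_mul_sub_add (fderiv ℝ (v t) x) (fderiv ℝ (V t) x)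
        -- `|∇V(t,x)|² ≤ 3‖∇V‖² ≤ 3 CV²/t ≤ 3CV²/δ`
        have hVg : frobeniusNormSq (fderiv ℝ (V t) x) ≤ 3 * (CV ^ 2 / δ) := by
          refine (frobeniusNormSq_le_three_mul_norm_sq _).trans ?_
          have h1 := hCV t htL x
          have ht0 : 0 < t := htS.1
          have hsq : (t ^ (1 / 2 : ℝ)) ^ 2 = t := by
            rw [← Real.rpow_natCast, ← Real.rpow_mul ht0.le]; norm_num
          have hn : ‖fderiv ℝ (V t) x‖ ^ 2 ≤ CV ^ 2 / t := by
            rw [le_div_iff₀ ht0]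
            have h0 : 0 ≤ t ^ (1 / 2 : ℝ) * ‖fderiv ℝ (V t) x‖ := by positivity
            calc ‖fderiv ℝ (V t) x‖ ^ 2 * t = (t ^ (1 / 2 : ℝ) * ‖fderiv ℝ (V t) x‖) ^ 2 := by
                  rw [mul_pow, hsq]; ring
              _ ≤ CV ^ 2 := pow_le_pow_left₀ h0 h1 2
          have hmono : CV ^ 2 / t ≤ CV ^ 2 / δ :=
            div_le_div_of_nonneg_left (sq_nonneg _) hδ0 ht.1.le
          linarith
        calc ENNReal.ofReal (frobeniusNormSq (fderiv ℝ (v t) x))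
            ≤ ENNReal.ofReal (2 * frobeniusNormSq (fderiv ℝ (v t) x - fderiv ℝ (V t) x) + 2 * (3 * (CV ^ 2 / δ))) := by
              refine ENNReal.ofReal_le_ofReal (hfrob.trans ?_); linarith
          _ = 2 * ENNReal.ofReal (frobeniusNormSq (fderiv ℝ (fun y => v t y - V t y) x)) + c₂ := by
              have hnn : 0 ≤ 2 * frobeniusNormSq (fderiv ℝ (v t) x - fderiv ℝ (V t) x) :=
                mul_nonneg zero_le_two (frobeniusNormSq_nonneg _)
              have hnn' : 0 ≤ 2 * (3 * (CV ^ 2 / δ)) := by positivity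
              rw [hsub, ENNReal.ofReal_add hnn hnn', ENNReal.ofReal_mul zero_le_two,
                ENNReal.ofReal_ofNat, hc₂]
              congr 1; congr 1; ring
      calc ∫⁻ z in Ioo δ S ×ˢ ball x₀ R, F z
          ≤ ∫⁻ z in Ioo δ S ×ˢ ball x₀ R,
              (2 * ENNReal.ofReal (frobeniusNormSq (fderiv ℝ (fun y => v z.1 y - V z.1 y) z.2)) + c₂) :=
            setLIntegral_mono' (measurableSet_Ioo.prod measurableSet_ball) hptw
        _ = 2 * (∫⁻ z in Ioo δ S ×ˢ ball x₀ R, ENNReal.ofReal (frobeniusNormSq (fderiv ℝ (fun y => v z.1 y - V z.1 y) z.2))) +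
              c₂ * volume (Ioo δ S ×ˢ ball x₀ R) := by
            rw [lintegral_add_right _ measurable_const, lintegral_const_mul' _ _ ENNReal.ofNat_ne_top,
              setLIntegral_const]
        _ ≤ 2 * ENNReal.ofReal Dtot + c₂ * vol := by
            gcongr
            · calc ∫⁻ z in Ioo δ S ×ˢ ball x₀ R, ENNReal.ofReal (frobeniusNormSq (fderiv ℝ (fun y => v z.1 y - V z.1 y) z.2))
                  ≤ ∫⁻ z in Ioo 0 S ×ˢ (univ : Set (EuclideanSpace ℝ (Fin 3))),
                      ENNReal.ofReal (frobeniusNormSq (fderiv ℝ (fun y => v z.1 y - V z.1 y) z.2)) :=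
                    lintegral_mono_set (prod_mono (Ioo_subset_Ioo_left hδ0.le) (subset_univ _))
                _ ≤ ENNReal.ofReal Dtot := hWdiss0
    calc ∫⁻ z in Ioo 0 S ×ˢ ball x₀ R, F z
        ≤ ∫⁻ z in Ioc (0 : ℝ) δ ×ˢ ball x₀ R ∪ Ioo δ S ×ˢ ball x₀ R, F z := lintegral_mono_set hsplit
      _ ≤ (∫⁻ z in Ioc (0 : ℝ) δ ×ˢ ball x₀ R, F z) + ∫⁻ z in Ioo δ S ×ˢ ball x₀ R, F z := lintegral_union_le _ _ _
      _ ≤ c₁ * vol + (2 * ENNReal.ofReal Dtot + c₂ * vol) := add_le_add hP1 hP2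
  · -- ### the datum in `L²_loc`
    intro K hK
    have hc : Tendsto (fun τ => eLpNorm (u τ - u t₀) p volume) (𝓝[Ioo 0 T] t₀) (𝓝 0) :=
      h.continuousInLpOn.2 t₀ ht₀
    have hshift : Tendsto (fun t : ℝ => t + t₀) (𝓝[>] 0) (𝓝[Ioo 0 T] t₀) := by
      refine tendsto_nhdsWithin_of_tendsto_nhds_of_eventually_within _ ?_ ?_
      · have : Tendsto (fun t : ℝ => t + t₀) (𝓝 0) (𝓝 (0 + t₀)) :=
          (continuous_id.add continuous_const).tendsto 0
        rw [zero_add] at this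
        exact this.mono_left nhdsWithin_le_nhds
      · filter_upwards [Ioo_mem_nhdsGT (sub_pos.2 ht₀.2)] with t ht
        exact ⟨by linarith [ht.1, ht₀.1], by linarith [ht.2]⟩
    have hN := hc.comp hshift
    set Vc : ℝ≥0∞ := volume K ^ (1 / 2 - 1 / p.toReal : ℝ) with hVc
    have hVtop : Vc ≠ ⊤ := ENNReal.rpow_ne_top_of_nonneg (by
      rw [sub_nonneg]
      exact one_div_le_one_div_of_le (by norm_num) (by linarith)) hK.measure_lt_top.ne
    have hmaj : Tendsto (fun t => (eLpNorm (u (t + t₀) - u t₀) p volume * Vc) ^ 2)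
        (𝓝[>] 0) (𝓝 0) := by
      have h1 := ENNReal.Tendsto.mul_const hN (Or.inr hVtop)
      rw [zero_mul] at h1
      have h2 := ((ENNReal.continuous_pow 2).tendsto 0).comp h1
      rw [zero_pow two_ne_zero] at h2
      exact h2
    have hev : ∀ᶠ t in 𝓝[>] (0 : ℝ), ∫⁻ x in K, ‖v t x - u t₀ x‖ₑ ^ 2 ≤
        (eLpNorm (u (t + t₀) - u t₀) p volume * Vc) ^ 2 := by
      filter_upwards [Ioo_mem_nhdsGT (sub_pos.2 ht₀.2)] with t ht
      have htt : t + t₀ ∈ Ioo 0 T := ⟨by linarith [ht.1, ht₀.1], by linarith [ht.2]⟩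
      have hae : v t =ᵐ[volume] u (t + t₀) := hvu t ⟨ht.1.le, ht.2⟩
      have hm : AEStronglyMeasurable (u (t + t₀) - u t₀) (volume.restrict K) :=
        ((h.memLp_and_memLp_top htt).1.sub (h.memLp_and_memLp_top ht₀).1).1.restrict
      calc ∫⁻ x in K, ‖v t x - u t₀ x‖ₑ ^ 2 = ∫⁻ x in K, ‖(u (t + t₀) - u t₀) x‖ₑ ^ 2 := by
            refine lintegral_congr_ae ((ae_restrict_of_ae hae).mono fun x hx => ?_)
            show ‖v t x - u t₀ x‖ₑ ^ 2 = ‖(u (t + t₀) - u t₀) x‖ₑ ^ 2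
            rw [Pi.sub_apply, hx]
        _ ≤ (eLpNorm (u (t + t₀) - u t₀) p (volume.restrict K) *
              (volume.restrict K) univ ^ (1 / 2 - 1 / p.toReal : ℝ)) ^ 2 :=
            lintegral_enorm_sq_le_sq_eLpNorm_mul hm h2p
        _ ≤ (eLpNorm (u (t + t₀) - u t₀) p volume * Vc) ^ 2 := by
            rw [Measure.restrict_apply_univ]
            gcongr
            exact Measure.restrict_le_self
    exact tendsto_of_tendsto_of_tendsto_of_le_of_le' tendsto_const_nhds hmaj
      (Eventually.of_forall fun _ => bot_le) hev
  · -- ### decay at spatial infinity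
    intro R hR
    -- the `W`-part: tails of a finite strip integral
    have hIW : Tendsto (fun x₀ : EuclideanSpace ℝ (Fin 3) =>
        ∫⁻ z in Ioo 0 S ×ˢ ball x₀ R, ‖v z.1 z.2 - V z.1 z.2‖ₑ ^ 2) (cocompact (EuclideanSpace ℝ (Fin 3))) (𝓝 0) :=
      tendsto_setLIntegral_strip_ball_cocompact ((hvmeas.sub hVmeas).enorm.pow_const _) hWstrip_top R
    -- the `V`-part: `V ∈ L^p` of the strip (Tonelli) and Hölder on the cylinders
    have hLpS : ∀ t ∈ Ioo 0 S, eLpNorm (V t) p volume ≤ NV := fun t ht => (hNV t (hIooL ht)).2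
    have hfin : ∫⁻ z in Ioo 0 S ×ˢ (univ : Set (EuclideanSpace ℝ (Fin 3))), ‖V z.1 z.2‖ₑ ^ p.toReal ≠ ⊤ := by
      refine ne_of_lt ?_
      rw [volume_restrict_prod_univ_eq_prod]
      calc ∫⁻ z, ‖V z.1 z.2‖ₑ ^ p.toReal ∂((volume.restrict (Ioo 0 S)).prod volume)
          ≤ ∫⁻ t in Ioo 0 S, ∫⁻ x, ‖V t x‖ₑ ^ p.toReal :=
            lintegral_prod_le (μ := volume.restrict (Ioo 0 S)) (ν := (volume : Measure (EuclideanSpace ℝ (Fin 3))))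
              (fun z : ℝ × (EuclideanSpace ℝ (Fin 3)) => ‖V z.1 z.2‖ₑ ^ p.toReal)
        _ ≤ ∫⁻ _ in Ioo 0 S, (NV : ℝ≥0∞) ^ p.toReal := by
            refine lintegral_mono_ae ((ae_restrict_mem measurableSet_Ioo).mono fun t ht => ?_)
            rw [lintegral_enorm_rpow_toReal_eq (V t) hp0 hptop]
            exact ENNReal.rpow_le_rpow (hLpS t ht) hr0.le
        _ < ⊤ := by
            rw [setLIntegral_const]
            exact ENNReal.mul_lt_top (ENNReal.rpow_lt_top_of_nonneg hr0.le ENNReal.coe_ne_top) measure_Ioo_lt_top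
    have hI : Tendsto (fun x₀ : (EuclideanSpace ℝ (Fin 3)) => ∫⁻ z in Ioo 0 S ×ˢ ball x₀ R, ‖V z.1 z.2‖ₑ ^ p.toReal)
        (cocompact (EuclideanSpace ℝ (Fin 3))) (𝓝 0) :=
      tendsto_setLIntegral_strip_ball_cocompact (hVmeas.enorm.pow_const _) hfin R
    set Vc : ℝ≥0∞ := (volume (Ioo (0 : ℝ) S) * volume (ball (0 : (EuclideanSpace ℝ (Fin 3))) R)) ^ (1 / 2 - 1 / p.toReal : ℝ)
      with hVc
    have hVtop : Vc ≠ ⊤ := ENNReal.rpow_ne_top_of_nonneg (by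
      rw [sub_nonneg]
      exact one_div_le_one_div_of_le (by norm_num) (by linarith))
      (ENNReal.mul_lt_top measure_Ioo_lt_top measure_ball_lt_top).ne
    have hbound : ∀ x₀ : (EuclideanSpace ℝ (Fin 3)), ∫⁻ z in Ioo 0 S ×ˢ ball x₀ R, ‖V z.1 z.2‖ₑ ^ 2 ≤
        ((∫⁻ z in Ioo 0 S ×ˢ ball x₀ R, ‖V z.1 z.2‖ₑ ^ p.toReal) ^ (1 / p.toReal) * Vc) ^ 2 := by
      intro x₀
      have hm : AEStronglyMeasurable (uncurry V) (volume.restrict (Ioo 0 S ×ˢ ball x₀ R)) :=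
        hVmeas.mono_measure (Measure.restrict_mono (Set.prod_mono Subset.rfl (subset_univ _)) le_rfl)
      have hH := lintegral_enorm_sq_le_sq_eLpNorm_mul hm h2p
      rw [Measure.restrict_apply_univ, volume_Ioo_prod_ball, eLpNorm_eq_lintegral_rpow_enorm_toReal hp0 hptop] at hH
      exact hH
    have hIV : Tendsto (fun x₀ : (EuclideanSpace ℝ (Fin 3)) =>
        ((∫⁻ z in Ioo 0 S ×ˢ ball x₀ R, ‖V z.1 z.2‖ₑ ^ p.toReal) ^ (1 / p.toReal) * Vc) ^ 2)
        (cocompact (EuclideanSpace ℝ (Fin 3))) (𝓝 0) := by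
      have h1 := ((ENNReal.continuous_rpow_const (y := (1 / p.toReal : ℝ))).tendsto 0).comp hI
      rw [ENNReal.zero_rpow_of_pos (by positivity)] at h1
      have h2 := ENNReal.Tendsto.mul_const h1 (Or.inr hVtop)
      rw [zero_mul] at h2
      have h3 := ((ENNReal.continuous_pow 2).tendsto 0).comp h2
      rw [zero_pow two_ne_zero] at h3
      exact h3
    -- `|v|² ≤ 2|W|² + 2|V|²`
    have hmaj : Tendsto (fun x₀ : EuclideanSpace ℝ (Fin 3) =>
        2 * (∫⁻ z in Ioo 0 S ×ˢ ball x₀ R, ‖v z.1 z.2 - V z.1 z.2‖ₑ ^ 2) +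
          2 * ((∫⁻ z in Ioo 0 S ×ˢ ball x₀ R, ‖V z.1 z.2‖ₑ ^ p.toReal) ^ (1 / p.toReal) * Vc) ^ 2)
        (cocompact (EuclideanSpace ℝ (Fin 3))) (𝓝 0) := by
      have h1 := ENNReal.Tendsto.const_mul hIW (Or.inr ENNReal.ofNat_ne_top) (a := 2)
      have h2 := ENNReal.Tendsto.const_mul hIV (Or.inr ENNReal.ofNat_ne_top) (a := 2)
      rw [mul_zero] at h1 h2
      simpa using h1.add h2
    refine tendsto_of_tendsto_of_tendsto_of_le_of_le' tendsto_const_nhds hmaj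
      (Eventually.of_forall fun _ => bot_le) (Eventually.of_forall fun x₀ => ?_)
    have hmW : AEMeasurable (fun z : ℝ × EuclideanSpace ℝ (Fin 3) => ‖v z.1 z.2 - V z.1 z.2‖ₑ ^ 2)
        (volume.restrict (Ioo 0 S ×ˢ ball x₀ R)) :=
      ((hvmeas.sub hVmeas).enorm.pow_const _).mono_measure
        (Measure.restrict_mono (Set.prod_mono Subset.rfl (subset_univ _)) le_rfl)
    calc ∫⁻ z in Ioo 0 S ×ˢ ball x₀ R, ‖v z.1 z.2‖ₑ ^ 2
        ≤ ∫⁻ z in Ioo 0 S ×ˢ ball x₀ R, (2 * ‖v z.1 z.2 - V z.1 z.2‖ₑ ^ 2 + 2 * ‖V z.1 z.2‖ₑ ^ 2) :=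
          lintegral_mono fun z => enorm_sq_le_two_mul _ _
      _ = 2 * (∫⁻ z in Ioo 0 S ×ˢ ball x₀ R, ‖v z.1 z.2 - V z.1 z.2‖ₑ ^ 2) +
            2 * ∫⁻ z in Ioo 0 S ×ˢ ball x₀ R, ‖V z.1 z.2‖ₑ ^ 2 := by
          rw [lintegral_add_left' (hmW.const_mul _), lintegral_const_mul'' _ hmW,
            lintegral_const_mul' _ _ ENNReal.ofNat_ne_top]
      _ ≤ _ := by gcongr; exact hbound x₀

end Clauses

/-! ### §5 The far field of Albritton's class, and Cor. 4.6 over the class -/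

section FarField

variable {p q : ℝ≥0∞} [hp1 : Fact (1 ≤ p)] {T ν : ℝ}
  {u : ℝ → EuclideanSpace ℝ (Fin 3) → EuclideanSpace ℝ (Fin 3)}
  {U : ℝ → 𝓢'(EuclideanSpace ℝ (Fin 3), EuclideanSpace ℂ (Fin 3))}

/-- **The far-field bound of Albritton's class up to the blow-up time, unit viscosity**
(Albritton 2018, proof of Prop. 4.5, (4.37): "there exist constants `R, κ > 0`, and the set
`K := (ℝ³ ∖ B(R)) × (T*/2, T*)`, such that `sup_K |u(x,t)| < κ`"). Restart at `t₀ = T/2`; the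
classical representative `v` of `u(· + t₀)` is a local Leray solution on the full slab
`(0, T/2) × ℝ³` (`isLocalLeraySolutionOn_full`, fed by `exists_calderon_remainder`), so the
accepted ε-regularity far-field theorem `IsLocalLeraySolutionOn.farField_bound_of_pressure_decay`
bounds `v` on `(T/4, T/2) × {|x| > R}`; the bound transfers to `u(· + T/2)` (slice-wise a.e.
equality and Fubini) and to `u` (time translation). [cite: Albritton2018, Prop. 4.5 (proof, (4.32)–(4.37)); LemarieRieusset2016 Thm. 14.4 and proof of Thm. 14.5 (pp. 511–512)] -/
theorem katoClass_farField_unit (hp₃ : 3 < p) (hp : p < ⊤) (hq₁ : 1 ≤ q) (hq : q < ⊤) (hT : 0 < T)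
    (h : IsKatoBesovMildSolutionOn p q T 1 u U) :
    ∃ δ : ℝ, 0 < δ ∧ ∃ R : ℝ, eLpNorm (uncurry u) ⊤
      (volume.restrict (Ioo (T - δ) T ×ˢ (closedBall (0 : (EuclideanSpace ℝ (Fin 3))) R)ᶜ)) < ⊤ := by
  set t₀ : ℝ := T / 2 with ht₀_def
  have ht₀ : t₀ ∈ Ioo 0 T := ⟨by rw [ht₀_def]; positivity, by rw [ht₀_def]; linarith⟩
  set T' : ℝ := T - t₀ with hT'_def
  have hT' : 0 < T' := by rw [hT'_def]; linarith [ht₀.2]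
  obtain ⟨v, π, V, πV, L, M, Λ₀, hvcl, hvu, -, hgrads, hLpb, -, hSL, hM, hVcl, hVbd, hVp, hVgrad,
    -, hWL2, hWdiss⟩ := AlbrittonRemainderSetup.exists_calderon_remainder hp₃ hp hq₁ hq hT h ht₀
  obtain ⟨π', hLL⟩ := isLocalLeraySolutionOn_full hp₃ hp hT h ht₀ hvcl hvu hgrads hLpb hSL hM
    hVcl hVbd hVp hVgrad hWL2 hWdiss
  have hvcont : ContinuousOn (uncurry v) (Ioo (-(t₀ / 2)) (T - t₀) ×ˢ univ) := hvcl.smooth_velocity.continuousOn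
  -- measurability of `v` on the strip `(0, T') × ℝ³`
  have hstripO : Ioo (0 : ℝ) T' ×ˢ (univ : Set (EuclideanSpace ℝ (Fin 3))) ⊆ Ioo (-(t₀ / 2)) (T - t₀) ×ˢ univ :=
    prod_mono (fun t ht => ⟨by linarith [ht.1, ht₀.1], by rw [hT'_def] at ht; exact ht.2⟩) Subset.rfl
  have hvmeas : AEStronglyMeasurable (uncurry v) (volume.restrict (Ioo (0 : ℝ) T' ×ˢ (univ : Set (EuclideanSpace ℝ (Fin 3))))) :=
    (hvcont.mono hstripO).aestronglyMeasurable (measurableSet_Ioo.prod MeasurableSet.univ)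
  -- the far-field bound of `v` on the window `(T'/2, T')` of the slab `(0, T')`
  obtain ⟨R, hR⟩ := hLL.farField_bound_of_pressure_decay lemarieRieusset_epsilon_regularity_holds
    one_pos (c := fun x₀ t => ⨍ y in ball x₀ (3 / 2), π' t y)
    (fun x₀ => hLL.memLp_setAverage_pressure x₀ (by norm_num))
    hLL.tendsto_lintegral_pressure_sub_average (t₁ := T' / 2) (t₂ := T') (by positivity) le_rfl
  -- transfer to the shifted solution `u(· + t₀)`
  set W : Set (ℝ × (EuclideanSpace ℝ (Fin 3))) := Ioo (T' / 2) T' ×ˢ (closedBall (0 : (EuclideanSpace ℝ (Fin 3))) R)ᶜ with hW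
  have hWsub : W ⊆ Ioo 0 T' ×ˢ (univ : Set (EuclideanSpace ℝ (Fin 3))) :=
    prod_mono (Ioo_subset_Ioo (by positivity) le_rfl) (subset_univ _)
  set us : ℝ → (EuclideanSpace ℝ (Fin 3)) → (EuclideanSpace ℝ (Fin 3)) := fun t => u (t + t₀) with hus
  have husmeas : AEStronglyMeasurable (uncurry us) (volume.restrict (Ioo (0 : ℝ) T' ×ˢ (univ : Set (EuclideanSpace ℝ (Fin 3))))) := by
    rw [hT'_def]
    exact aestronglyMeasurable_uncurry_translate ht₀.1.le h.isBesovMildSolutionOn.aestronglyMeasurable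
  have hvus : uncurry v =ᵐ[volume.restrict (Ioo 0 T' ×ˢ (univ : Set (EuclideanSpace ℝ (Fin 3))))] uncurry us :=
    ae_eq_strip_of_ae_slice hvmeas husmeas
      ((ae_restrict_mem measurableSet_Ioo).mono fun t ht => hvu t ⟨ht.1.le, ht.2⟩)
  have husW : eLpNorm (uncurry us) ⊤ (volume.restrict W) < ⊤ := by
    rw [← eLpNorm_congr_ae (ae_restrict_of_ae_restrict_of_subset hWsub hvus)]
    exact hR
  -- undo the time translation
  refine ⟨T' / 2, by positivity, R, ?_⟩
  have hfun : uncurry u = uncurry us ∘ stAffine 1 1 (-t₀) (0 : (EuclideanSpace ℝ (Fin 3))) := by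
    funext ⟨r, y⟩
    simp [hus, uncurry, stAffine]
  have hpre : stAffine 1 1 (-t₀) (0 : (EuclideanSpace ℝ (Fin 3))) ⁻¹' W =
      Ioo (T - T' / 2) T ×ˢ (closedBall (0 : (EuclideanSpace ℝ (Fin 3))) R)ᶜ := by
    ext ⟨r, y⟩
    simp only [hW, mem_preimage, stAffine_apply, one_mul, one_smul, zero_add, mem_prod, mem_Ioo,
      hT'_def]
    constructor
    · rintro ⟨⟨h1, h2⟩, h3⟩; exact ⟨⟨by linarith, by linarith⟩, h3⟩
    · rintro ⟨⟨h1, h2⟩, h3⟩; exact ⟨⟨by linarith, by linarith⟩, h3⟩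
  rw [hfun, ← hpre, eLpNorm_top_comp_stAffine_restrict_preimage one_pos one_pos]
  exact husW

/-- **The far-field bound of Albritton's class, every viscosity `ν > 0`** — the hypothesis `hC`
of `katoClass_singular_point_of_farField`, now a theorem: normalise the viscosity
(`IsKatoBesovMildSolutionOn.timeRescale`), apply `katoClass_farField_unit`, pull the far-field
slab back (`eLpNorm_top_comp_stAffine_restrict_preimage`). [cite: Albritton2018, Prop. 4.5 (proof, (4.32)–(4.37))] -/
theorem katoClass_farField (hν : 0 < ν) (hp₃ : 3 < p) (hp : p < ⊤) (hq₁ : 1 ≤ q) (hq : q < ⊤)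
    (hT : 0 < T) (h : IsKatoBesovMildSolutionOn p q T ν u U) :
    ∃ δ : ℝ, 0 < δ ∧ ∃ R : ℝ, eLpNorm (uncurry u) ⊤
      (volume.restrict (Ioo (T - δ) T ×ˢ (closedBall (0 : (EuclideanSpace ℝ (Fin 3))) R)ᶜ)) < ⊤ := by
  set a : ℝ := ν⁻¹ with hadef
  have ha : 0 < a := by rw [hadef]; positivity
  have haν : a * ν = 1 := by rw [hadef, inv_mul_cancel₀ hν.ne']
  have hw : IsKatoBesovMildSolutionOn p q (T / a) 1 (FluidPDE.timeRescale a a u) fun t => (a : ℂ) • U (a * t) := by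
    rw [← haν]; exact h.timeRescale ha
  have hTa : 0 < T / a := div_pos hT ha
  obtain ⟨δ', hδ', R, hR⟩ := katoClass_farField_unit hp₃ hp hq₁ hq hTa hw
  have hTa' : T / a = ν * T := by rw [hadef, div_inv_eq_mul, mul_comm]
  refine ⟨δ' / ν, div_pos hδ' hν, R, ?_⟩
  have hwin : Ioo (T - δ' / ν) T ×ˢ (closedBall (0 : (EuclideanSpace ℝ (Fin 3))) R)ᶜ =
      stAffine ν 1 0 (0 : (EuclideanSpace ℝ (Fin 3))) ⁻¹' (Ioo (T / a - δ') (T / a) ×ˢ (closedBall (0 : (EuclideanSpace ℝ (Fin 3))) R)ᶜ) := by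
    rw [show T / a - δ' = ν * (T - δ' / ν) by rw [hTa']; field_simp, hTa',
      stAffine_preimage_Ioo_prod hν]
  rw [uncurry_eq_smul_timeRescale_comp_stAffine hν.ne' u, eLpNorm_const_smul, hwin,
    eLpNorm_top_comp_stAffine_restrict_preimage hν one_pos 0 (0 : (EuclideanSpace ℝ (Fin 3))) _ _, ← hadef]
  exact ENNReal.mul_lt_top enorm_lt_top hR

/-- **Albritton 2018, Cor. 4.6, over Albritton's class** ("Let `u` be the mild solution of
Theorem 4.2 with initial data `u₀`. If `T*(u₀) < ∞`, then `u` has a singular point at time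
`T*(u₀)`"): a maximal member of Albritton's class `IsMaximalKatoBesovMildSolution p q T ν u U`,
`3 < p, q < ∞`, `0 < T`, `0 < ν`, has a singular point `(T, x₀)` — `u` is essentially unbounded
on every parabolic cylinder `Q_r(T, x₀)`, `r² < T`. The accepted reduction
`katoClass_singular_point_of_farField` (its `L^∞`-continuation half is the accepted
`albritton_continuation_katoClass`) fed with the far-field theorem `katoClass_farField`.
[cite: Albritton2018, Cor. 4.6 with Prop. 4.5 and Thm. 4.2 (i)] -/
theorem katoClass_singular_point ⦃ν : ℝ⦄ (hν : 0 < ν) ⦃p q : ℝ≥0∞⦄ [Fact (1 ≤ p)]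
    (hp₃ : 3 < p) (hp : p < ⊤) (hq₃ : 3 < q) (hq : q < ⊤) ⦃T : ℝ⦄ (hT : 0 < T)
    ⦃u : ℝ → (EuclideanSpace ℝ (Fin 3)) → (EuclideanSpace ℝ (Fin 3))⦄
    ⦃U : ℝ → 𝓢'((EuclideanSpace ℝ (Fin 3)), (EuclideanSpace ℂ (Fin 3)))⦄
    (hmax : IsMaximalKatoBesovMildSolution p q T ν u U) :
    ∃ x₀ : (EuclideanSpace ℝ (Fin 3)), ∀ r : ℝ, 0 < r → r ^ 2 < T →
      eLpNorm (uncurry u) ⊤ (volume.restrict (parabolicCylinder r ((T : ℝ), x₀))) = ⊤ :=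
  katoClass_singular_point_of_farField
    (fun hν' _ _ _ hp₃' hp' hq₃' hq' _ hT' _ _ h' =>
      katoClass_farField hν' hp₃' hp' (le_trans (by norm_num) hq₃'.le) hq' hT' h')
    hν hp₃ hp hq₃ hq hT hmax

end FarField

end AlbrittonFarFieldCalderon

end Literature.Analysis.FluidPDE

end
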